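import Literature.AlgebraicTopology.SingularHomology.LocalHomologyVanishing
import Literature.AlgebraicTopology.SingularHomology.CollapseMap
import Literature.AlgebraicTopology.SingularHomology.LocalHomologyCharts
import Literature.AlgebraicTopology.SingularHomology.LefschetzDuality
import Mathlib.Analysis.Convex.Contractible
import Mathlib.Analysis.Normed.Module.Convex
import Mathlib.Topology.Homotopy.Equiv
import Mathlib.Geometry.Manifold.IsManifold.InteriorBoundary
import Mathlib.Geometry.Manifold.Instances.Real
import HarnessLib

/-!
# Local generators across boundary points: the relative fundamental class of a manifold with
boundary from its boundary class (half-ball models, no compactness)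

For a `C¹` (e.g. smooth) topological `(n+1)`-manifold with boundary `X` (`n ≥ 1`; Hausdorff; charts
in `EuclideanHalfSpace (n+1)`, boundary `∂X = (𝓡∂ (n+1)).boundary X`) and a relative class
`w ∈ Hₙ₊₁(X, ∂X; R)` over any commutative ring `R`:

**Main theorem** (`isRelFundamentalClass_of_isGenerator_toLocal_δ_of_isManifold`). If the local
image of `∂w ∈ Hₙ(∂X; R)` at every boundary point `y` generates `Hₙ(∂X | y; R)`, and every
connected component of `X` meets `∂X`, then `w` is a relative fundamental class of `(X, ∂X)`
(`IsRelFundamentalClass`, Spanier's definition: a generator of `Hₙ₊₁(X | x; R)` at every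
interior point `x`).

This is the converse direction of Spanier, *Algebraic Topology* (1966), Cor. 6.3.10 ("any
fundamental class of `X` maps to a fundamental class of `Ẋ` under `∂`"), which the tree uses —
through the named facts Spanier Thm. 6.3.5 (`relativeSingularHomology.exists_linearEquiv_of_ne_zero`)
and Cor. 6.3.10 (`isGenerator_toLocal_δ_of_isRelFundamentalClass`) of `LefschetzDuality.lean` — in
`Literature.Topology.FourManifolds.BordismFourOrientation` to normalize homological bordism data.
Here it is **proved directly and locally**, without compactness and without those named facts,
by the classical half-ball picture at a boundary point (Hatcher, *Algebraic Topology* (2002),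
§3.3, p. 252: "a point `x ∈ ∂M` has a neighbourhood homeomorphic to `ℝⁿ⁺ = {xₙ ≥ 0}` by a
homeomorphism taking `x` to a point of `∂ℝⁿ⁺`"; pp. 231–236 for local homology, excision and the
long exact sequences used).  The argument, for a boundary point `p` with half chart
`e : U → ℝ × ℝⁿ` (sup norm; `e p = 0`, `e(U ∩ ∂X) = {a = 0}`):

* Let `N⁺ = e⁻¹((0, 2h) × ball 0 h)` (the open sup-ball `ball (h,0) h`, touching `∂X` at `p`) and
  `z₁` the image of `w` in `Hₙ₊₁(X | N⁺)`.  Restriction `Hₙ₊₁(X | N⁺) → Hₙ₊₁(X | y)` to the centre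
  `y = e⁻¹(h, 0)` is an isomorphism (radial push-out; the closed sup-ball `[0,2h] × closedBall 0 h`
  lies in the closed half-space — Part IV adapts `LocalHomologyCharts.lean` to charts with
  non-open target), and `z₁ ↦ w|_y`.
* `Φ = (restriction to p) ∘ ∂ : Hₙ₊₁(X | N⁺) → Hₙ(X ∖ N⁺) → Hₙ(X ∖ N⁺ | p)` is an isomorphism
  (`HalfChart.isIso_Φ`): excise to the box `O = e⁻¹(ball 0 (4h)) ≅ [0,4h) × ball 0 (4h)`
  (contractible), where `∂` is an isomorphism, and `Hₙ(O ∖ N⁺) → Hₙ(O ∖ N⁺ | p)` is one because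
  `O ∖ N⁺ ∖ p ≅` the punctured arch is **contractible** (Part I: push the punctured boundary disc
  outwards, then everything upwards into a convex slab) and `O ∖ N⁺` is path connected.
* Naturality of `∂` and of localization gives `Φ(z₁) = j(∂w|ₚ)` for the local inclusion
  `j : Hₙ(∂X | p) → Hₙ(X ∖ N⁺ | p)`, an isomorphism since `X ∖ N⁺` and `∂X` coincide near `p`.
  Hence `∂w|ₚ` generator ⟹ `z₁` generator ⟹ `w|_y` generator, and by local constancy on the
  convex `N⁺`, `w|ₓ` is a generator for every `x ∈ N⁺` (`HalfChart.isGenerator_toLocal_of_mem_core`).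
* Globally (Part VI): the set of bad interior points is open (good balls) and closed (its closure
  contains no boundary point by the above), hence a union of components of `X`, hence empty.

Parts I–IV are general tools: contractibility of the half-ball pieces (I); the coordinate model
`EuclideanHalfSpace (n+1) ≃ {0 ≤ a} ⊆ ℝ × ℝⁿ` and *boundary points in an arbitrary chart*
(`mem_boundary_iff_apply_zero_eq`, from Mathlib's `C¹` chart independence) (II); vanishing /
isomorphism criteria from the long exact sequence of a pair with contractible pieces and excision
for local homology at a set (III); the star-convex push-out lemma for `PartialEquiv` charts (IV).
Everything is proved; the file adds no named fact.  All spaces stay in their universe `u`; the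
only cross-universe transport is of `ContractibleSpace`/`PathConnectedSpace` along homeomorphisms
with the model pieces.

## References

* A. Hatcher, *Algebraic Topology*, CUP 2002, §2.1 (Thm. 2.13 ff., Thm. 2.20), §3.3 pp. 231–237
  (local homology, Lemma 3.27 step (3)), p. 252 (manifolds with boundary). [Hatcher2002]
* E. H. Spanier, *Algebraic Topology*, Springer 1981, Ch. 6 §3, Cor. 10. [Spanier1981]
-/

noncomputable section

universe u v


/-! ## Part I — Half-ball models in `ℝ × F` (sup norm): the half-box, the boundary ball, and the
contractibility of the punctured arch `halfBox (4h) ∖ (ball (h,0) h ∪ {0})` -/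



open Set Metric Topology unitInterval

namespace Literature.AlgebraicTopology.SingularHomology

namespace HalfBall

variable {F : Type*} [NormedAddCommGroup F]

/-! ### The half-box, the boundary ball, the arch and its two retracts -/

/-- The open half-box `[0, H) × ball 0 H ⊆ ℝ × F` (sup norm): `{0 ≤ a} ∩ ball 0 H`. [folklore] -/
def halfBox (H : ℝ) : Set (ℝ × F) := {v | 0 ≤ v.1} ∩ ball 0 H

/-- Membership in the half-box: `0 ≤ a < H` and `‖w‖ < H`. [folklore] -/
lemma mem_halfBox {H : ℝ} {v : ℝ × F} : v ∈ halfBox H ↔ 0 ≤ v.1 ∧ v.1 < H ∧ ‖v.2‖ < H := by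
  simp only [halfBox, mem_inter_iff, mem_setOf_eq, mem_ball, dist_zero_right, Prod.norm_def,
    max_lt_iff, Real.norm_eq_abs]
  constructor
  · rintro ⟨h0, h1, h2⟩
    exact ⟨h0, (abs_of_nonneg h0) ▸ h1, h2⟩
  · rintro ⟨h0, h1, h2⟩
    exact ⟨h0, (abs_of_nonneg h0).symm ▸ h1, h2⟩

/-- The origin lies in the half-box. [folklore] -/
lemma zero_mem_halfBox {H : ℝ} (hH : 0 < H) : (0 : ℝ × F) ∈ halfBox H :=
  mem_halfBox.2 ⟨le_rfl, hH, by simpa using hH⟩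

/-- Membership in the sup-ball `ball (h, 0) h = (0, 2h) × ball 0 h`. [folklore] -/
lemma mem_ball_boundary {h : ℝ} {v : ℝ × F} :
    v ∈ ball ((h, 0) : ℝ × F) h ↔ 0 < v.1 ∧ v.1 < 2 * h ∧ ‖v.2‖ < h := by
  rw [mem_ball, Prod.dist_eq, max_lt_iff, Real.dist_eq, dist_zero_right, abs_sub_lt_iff]
  constructor
  · rintro ⟨⟨h1, h2⟩, h3⟩
    exact ⟨by linarith, by linarith, h3⟩
  · rintro ⟨h1, h2, h3⟩
    exact ⟨⟨by linarith, by linarith⟩, h3⟩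

/-- The punctured arch `T = halfBox (4h) ∖ (ball (h,0) h ∪ {0})`: the half-box minus the open
boundary ball and the boundary point `0`. [folklore] -/
def arch (h : ℝ) : Set (ℝ × F) := halfBox (4 * h) \ (ball ((h, 0) : ℝ × F) h ∪ {0})

/-- The first retract `T₁ = {v ∈ halfBox (4h) | h ≤ ‖v.2‖ ∨ 2h ≤ v.1}`. [folklore] -/
def arch₁ (h : ℝ) : Set (ℝ × F) := {v | v ∈ halfBox (4 * h) ∧ (h ≤ ‖v.2‖ ∨ 2 * h ≤ v.1)}

/-- The second retract, the convex slab `T₂ = {v ∈ halfBox (4h) | 2h ≤ v.1}`. [folklore] -/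
def arch₂ (h : ℝ) : Set (ℝ × F) := {v | v ∈ halfBox (4 * h) ∧ 2 * h ≤ v.1}

/-- Membership in the punctured arch: a point of the half-box with `a = 0, w ≠ 0`, or `h ≤ ‖w‖`, or `2h ≤ a`. [folklore] -/
lemma mem_arch {h : ℝ} (hh : 0 < h) {v : ℝ × F} :
    v ∈ arch h ↔ v ∈ halfBox (4 * h) ∧ (v.1 = 0 ∧ v.2 ≠ 0 ∨ h ≤ ‖v.2‖ ∨ 2 * h ≤ v.1) := by
  rw [arch, mem_sdiff, mem_union, mem_ball_boundary, mem_singleton_iff]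
  constructor
  · rintro ⟨hv, hn⟩
    refine ⟨hv, ?_⟩
    have h0 := (mem_halfBox.1 hv).1
    by_cases ha : v.1 = 0
    · by_cases hw : v.2 = 0
      · exact absurd (Or.inr (Prod.ext ha hw)) hn
      · exact Or.inl ⟨ha, hw⟩
    · have ha' : 0 < v.1 := lt_of_le_of_ne h0 (Ne.symm ha)
      by_contra hc
      simp only [not_or, not_le] at hc
      exact hn (Or.inl ⟨ha', hc.2.2, hc.2.1⟩)
  · rintro ⟨hv, hc⟩
    refine ⟨hv, ?_⟩
    rintro (⟨h1, h2, h3⟩ | rfl)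
    · rcases hc with ⟨ha, _⟩ | hw | ha
      · exact absurd ha h1.ne'
      · exact absurd h3 (not_lt.2 hw)
      · exact absurd h2 (not_lt.2 ha)
    · rcases hc with ⟨_, hw⟩ | hw | ha
      · exact hw rfl
      · exact absurd hw (not_le.2 (by simpa using hh))
      · exact absurd ha (not_le.2 (by simp; linarith))

/-- The slab `T₂` lies in `T₁`. [folklore] -/
lemma arch₂_subset_arch₁ {h : ℝ} : arch₂ (F := F) h ⊆ arch₁ h := fun _ hv => ⟨hv.1, Or.inr hv.2⟩

/-- `T₁` lies in the arch. [folklore] -/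
lemma arch₁_subset_arch {h : ℝ} (hh : 0 < h) : arch₁ (F := F) h ⊆ arch h := fun _ hv =>
  (mem_arch hh).2 ⟨hv.1, Or.inr hv.2⟩

/-- The arch lies in the half-box. [folklore] -/
lemma arch_subset_halfBox {h : ℝ} : arch (F := F) h ⊆ halfBox (4 * h) := sdiff_subset

/-- The point `(3h, 0)` lies in the slab `T₂`. [folklore] -/
lemma mem_arch₂_of {h : ℝ} (hh : 0 < h) : ((3 * h, 0) : ℝ × F) ∈ arch₂ h :=
  ⟨mem_halfBox.2 ⟨by linarith, by linarith, by simp; linarith⟩, by linarith⟩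

/-- In the arch, a point with second coordinate of norm `< h` and first coordinate `≠ 0` lies in
the slab `{2h ≤ a}`. [folklore] -/
lemma two_mul_le_of_mem_arch {h : ℝ} (hh : 0 < h) {v : ℝ × F} (hv : v ∈ arch h)
    (hw : ‖v.2‖ < h) (ha : v.1 ≠ 0) : 2 * h ≤ v.1 := by
  rcases ((mem_arch hh).1 hv).2 with ⟨ha', _⟩ | hw' | ha'
  · exact absurd ha' ha
  · exact absurd hw (not_lt.2 hw')
  · exact ha'

/-! ### Pushing upwards: `T₁ ≃ₕ T₂` -/

/-- The upward push `G_t (a, w) = (a + t (2h - a/2), w)`. [folklore] -/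
def pushUp (h t : ℝ) (v : ℝ × F) : ℝ × F := (v.1 + t * (2 * h - v.1 / 2), v.2)

/-- The upward push is jointly continuous. [folklore] -/
lemma continuous_pushUp (h : ℝ) : Continuous fun p : ℝ × (ℝ × F) => pushUp h p.1 p.2 := by
  unfold pushUp
  fun_prop

omit [NormedAddCommGroup F] in
/-- At time `0` the upward push is the identity. [folklore] -/
lemma pushUp_zero (h : ℝ) (v : ℝ × F) : pushUp h 0 v = v := by
  simp [pushUp]

/-- The upward push preserves `T₁`. [folklore] -/
lemma pushUp_mem_arch₁ {h : ℝ} {t : ℝ} (ht0 : 0 ≤ t) (ht1 : t ≤ 1) {v : ℝ × F}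
    (hv : v ∈ arch₁ h) : pushUp h t v ∈ arch₁ h := by
  obtain ⟨hv, hc⟩ := hv
  obtain ⟨h0, h1, h2⟩ := mem_halfBox.1 hv
  have hpos : 0 ≤ 2 * h - v.1 / 2 := by linarith
  have hle : t * (2 * h - v.1 / 2) ≤ 2 * h - v.1 / 2 := by nlinarith
  have hge : 0 ≤ t * (2 * h - v.1 / 2) := mul_nonneg ht0 hpos
  refine ⟨mem_halfBox.2 ⟨?_, ?_, h2⟩, ?_⟩
  · show 0 ≤ v.1 + t * (2 * h - v.1 / 2)
    linarith
  · show v.1 + t * (2 * h - v.1 / 2) < 4 * h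
    linarith
  · rcases hc with hw | ha
    · exact Or.inl hw
    · right
      show 2 * h ≤ v.1 + t * (2 * h - v.1 / 2)
      linarith

/-- At time `1` the upward push lands in the slab `T₂`. [folklore] -/
lemma pushUp_one_mem_arch₂ {h : ℝ} {v : ℝ × F} (hv : v ∈ arch₁ h) :
    pushUp h 1 v ∈ arch₂ h := by
  refine ⟨(pushUp_mem_arch₁ zero_le_one le_rfl hv).1, ?_⟩
  obtain ⟨h0, _, _⟩ := mem_halfBox.1 hv.1
  show 2 * h ≤ v.1 + 1 * (2 * h - v.1 / 2)
  linarith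

/-- The upward push preserves `T₂`. [folklore] -/
lemma pushUp_mem_arch₂ {h : ℝ} {t : ℝ} (ht0 : 0 ≤ t) (ht1 : t ≤ 1) {v : ℝ × F}
    (hv : v ∈ arch₂ h) : pushUp h t v ∈ arch₂ h := by
  refine ⟨(pushUp_mem_arch₁ ht0 ht1 (arch₂_subset_arch₁ hv)).1, ?_⟩
  obtain ⟨h0, h1, _⟩ := mem_halfBox.1 hv.1
  have hpos : 0 ≤ 2 * h - v.1 / 2 := by linarith
  show 2 * h ≤ v.1 + t * (2 * h - v.1 / 2)
  nlinarith [hv.2]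

/-- `T₁` is homotopy equivalent to the slab `T₂` (push upwards). [folklore] -/
def archOneEquiv (h : ℝ) :
    ContinuousMap.HomotopyEquiv (arch₁ (F := F) h) (arch₂ (F := F) h) where
  toFun := ⟨fun v => ⟨pushUp h 1 v, pushUp_one_mem_arch₂ v.2⟩,
    ((continuous_pushUp h).comp (continuous_const.prodMk continuous_subtype_val)).subtype_mk _⟩
  invFun := ⟨fun v => ⟨v, arch₂_subset_arch₁ v.2⟩, continuous_subtype_val.subtype_mk _⟩
  left_inv :=
    ⟨{ toFun := fun p => ⟨pushUp h (1 - p.1) p.2,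
          pushUp_mem_arch₁ (by linarith [p.1.2.2]) (by linarith [p.1.2.1]) p.2.2⟩
       continuous_toFun := ((continuous_pushUp h).comp
          ((continuous_const.sub (continuous_induced_dom.comp continuous_fst)).prodMk
            (continuous_subtype_val.comp continuous_snd))).subtype_mk _
       map_zero_left := fun v => by ext1; simp
       map_one_left := fun v => by ext1; simp [pushUp_zero] }⟩
  right_inv :=
    ⟨{ toFun := fun p => ⟨pushUp h (1 - p.1) p.2,
          pushUp_mem_arch₂ (by linarith [p.1.2.2]) (by linarith [p.1.2.1]) p.2.2⟩
       continuous_toFun := ((continuous_pushUp h).comp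
          ((continuous_const.sub (continuous_induced_dom.comp continuous_fst)).prodMk
            (continuous_subtype_val.comp continuous_snd))).subtype_mk _
       map_zero_left := fun v => by ext1; simp
       map_one_left := fun v => by ext1; simp [pushUp_zero] }⟩

/-! ### Pushing outwards: `T ≃ₕ T₁` -/

/-- The taper `θ(a) = max 0 (1 - a / (2h))`: `1` on the boundary `a = 0`, `0` above `a = 2h`. [folklore] -/
def taper (h a : ℝ) : ℝ := max 0 (1 - a / (2 * h))

omit [NormedAddCommGroup F] in
/-- The taper is continuous. [folklore] -/
lemma continuous_taper (h : ℝ) : Continuous (taper h) := by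
  unfold taper
  fun_prop

/-- The taper is non-negative. [folklore] -/
lemma taper_nonneg (h a : ℝ) : 0 ≤ taper h a := le_max_left _ _

/-- The taper is at most `1` on `a ≥ 0`. [folklore] -/
lemma taper_le_one {h a : ℝ} (hh : 0 < h) (ha : 0 ≤ a) : taper h a ≤ 1 :=
  max_le zero_le_one (by have := div_nonneg ha (by linarith : (0 : ℝ) ≤ 2 * h); linarith)

/-- The taper vanishes above `a = 2h`. [folklore] -/
lemma taper_eq_zero {h a : ℝ} (hh : 0 < h) (ha : 2 * h ≤ a) : taper h a = 0 :=
  max_eq_left (by rw [sub_nonpos, le_div_iff₀ (by linarith)]; linarith)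

/-- The taper is `1` on the boundary `a = 0`. [folklore] -/
lemma taper_zero (h : ℝ) : taper h 0 = 1 := by simp [taper]

/-- The push factor `g(a, w) = max 1 (θ(a) h / ‖w‖)` (with `x / 0 = 0`). [folklore] -/
def pushFactor (h : ℝ) (v : ℝ × F) : ℝ := max 1 (taper h v.1 * h / ‖v.2‖)

/-- The push factor is at least `1`. [folklore] -/
lemma one_le_pushFactor (h : ℝ) (v : ℝ × F) : 1 ≤ pushFactor h v := le_max_left _ _

/-- The push factor is `1` on `T₁`. [folklore] -/
lemma pushFactor_eq_one {h : ℝ} (hh : 0 < h) {v : ℝ × F} (h0 : 0 ≤ v.1)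
    (hv : h ≤ ‖v.2‖ ∨ 2 * h ≤ v.1) : pushFactor h v = 1 := by
  refine max_eq_left ?_
  rcases hv with hw | ha
  · have hwpos : 0 < ‖v.2‖ := hh.trans_le hw
    rw [div_le_one hwpos]
    calc taper h v.1 * h ≤ 1 * h := by gcongr; exact taper_le_one hh h0
      _ = h := one_mul h
      _ ≤ ‖v.2‖ := hw
  · rw [taper_eq_zero hh ha, zero_mul, zero_div]
    exact zero_le_one

/-- On the punctured boundary disc the push factor moves `w` to norm `h`. [folklore] -/
lemma pushFactor_mul_norm_of_base {h : ℝ} {v : ℝ × F} (ha : v.1 = 0) (hw : v.2 ≠ 0)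
    (hwh : ‖v.2‖ < h) : pushFactor h v * ‖v.2‖ = h := by
  have hwpos : 0 < ‖v.2‖ := norm_pos_iff.2 hw
  have hq : 1 ≤ taper h v.1 * h / ‖v.2‖ := by
    rw [ha, taper_zero, one_mul, le_div_iff₀ hwpos, one_mul]
    exact hwh.le
  rw [pushFactor, max_eq_right hq, ha, taper_zero, one_mul, div_mul_cancel₀ _ hwpos.ne']

/-- The pushed second coordinate has norm at most `max ‖w‖ h`. [folklore] -/
lemma pushFactor_mul_norm_le {h : ℝ} (hh : 0 < h) {v : ℝ × F} (h0 : 0 ≤ v.1) :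
    pushFactor h v * ‖v.2‖ ≤ max ‖v.2‖ h := by
  by_cases hw : v.2 = 0
  · rw [hw, norm_zero, mul_zero]
    exact le_max_of_le_right hh.le
  · have hwpos : 0 < ‖v.2‖ := norm_pos_iff.2 hw
    rw [pushFactor, max_mul_of_nonneg _ _ hwpos.le, one_mul, div_mul_cancel₀ _ hwpos.ne']
    refine max_le_max le_rfl ?_
    calc taper h v.1 * h ≤ 1 * h := by gcongr; exact taper_le_one hh h0
      _ = h := one_mul h

/-- On the arch the push factor is continuous (it is `1` near the points with `w = 0`). [folklore] -/
lemma continuousOn_pushFactor {h : ℝ} (hh : 0 < h) : ContinuousOn (pushFactor (F := F) h) (arch h) := by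
  intro v hv
  by_cases hw : v.2 = 0
  · -- near `v`, every point of the arch lies in the slab `{2h ≤ a}`, where the factor is `1`
    have ha : 2 * h ≤ v.1 := by
      rcases ((mem_arch hh).1 hv).2 with ⟨_, hw'⟩ | hw' | ha'
      · exact absurd hw hw'
      · rw [hw, norm_zero] at hw'; linarith
      · exact ha'
    have hN : {u : ℝ × F | v.1 - h < u.1 ∧ ‖u.2‖ < h} ∈ 𝓝 v := by
      refine IsOpen.mem_nhds ?_ ⟨by linarith, by rw [hw, norm_zero]; exact hh⟩
      exact (isOpen_lt continuous_const continuous_fst).inter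
        (isOpen_lt (continuous_norm.comp continuous_snd) continuous_const)
    have heq : Set.EqOn (pushFactor h) (fun _ => (1 : ℝ)) (arch h ∩ {u : ℝ × F | v.1 - h < u.1 ∧ ‖u.2‖ < h}) := by
      rintro u ⟨hu, ⟨hu1, hu2⟩⟩
      have hu0 : 0 ≤ u.1 := (mem_halfBox.1 (arch_subset_halfBox hu)).1
      exact pushFactor_eq_one hh hu0 (Or.inr (two_mul_le_of_mem_arch hh hu hu2 (by intro h0; linarith)))
    refine ((continuousWithinAt_const (b := (1 : ℝ))).congr_of_eventuallyEq ?_ ?_)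
    · exact Filter.eventuallyEq_of_mem (inter_mem_nhdsWithin (arch h) hN) heq
    · exact pushFactor_eq_one hh (by linarith) (Or.inr ha)
  · have hwn : ‖v.2‖ ≠ 0 := norm_ne_zero_iff.2 hw
    refine ContinuousAt.continuousWithinAt ?_
    unfold pushFactor
    refine (continuousAt_const.max (ContinuousAt.div ?_ ?_ hwn))
    · exact (((continuous_taper h).comp continuous_fst).mul continuous_const).continuousAt
    · exact (continuous_norm.comp continuous_snd).continuousAt

section Push

variable [NormedSpace ℝ F]

/-- The outward push `F_t (a, w) = (a, (1 + t (g(a,w) - 1)) • w)`. [folklore] -/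
def pushOut (h t : ℝ) (v : ℝ × F) : ℝ × F := (v.1, (1 + t * (pushFactor h v - 1)) • v.2)

/-- At time `0` the outward push is the identity. [folklore] -/
lemma pushOut_zero (h : ℝ) (v : ℝ × F) : pushOut h 0 v = v := by
  simp [pushOut]

/-- The outward push fixes `T₁` pointwise. [folklore] -/
lemma pushOut_eq_self_of_mem_arch₁ {h : ℝ} (hh : 0 < h) (t : ℝ) {v : ℝ × F} (hv : v ∈ arch₁ h) :
    pushOut h t v = v := by
  rw [pushOut, pushFactor_eq_one hh (mem_halfBox.1 hv.1).1 hv.2]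
  simp

/-- The norm of the second coordinate of the outward push. [folklore] -/
lemma norm_pushOut_snd {h t : ℝ} (ht0 : 0 ≤ t) (v : ℝ × F) :
    ‖(pushOut h t v).2‖ = (1 + t * (pushFactor h v - 1)) * ‖v.2‖ := by
  rw [pushOut, norm_smul, Real.norm_of_nonneg]
  nlinarith [one_le_pushFactor h v]

/-- The outward push preserves the arch. [folklore] -/
lemma pushOut_mem_arch {h : ℝ} (hh : 0 < h) {t : ℝ} (ht0 : 0 ≤ t) (ht1 : t ≤ 1) {v : ℝ × F}
    (hv : v ∈ arch h) : pushOut h t v ∈ arch h := by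
  obtain ⟨hvb, hc⟩ := (mem_arch hh).1 hv
  obtain ⟨h0, h1, h2⟩ := mem_halfBox.1 hvb
  have hg := one_le_pushFactor h v
  have hμ1 : 1 ≤ 1 + t * (pushFactor h v - 1) := by nlinarith
  have hμg : 1 + t * (pushFactor h v - 1) ≤ pushFactor h v := by nlinarith
  have hnorm := norm_pushOut_snd (h := h) ht0 v
  have hge : ‖v.2‖ ≤ ‖(pushOut h t v).2‖ := by
    rw [hnorm]; nlinarith [norm_nonneg v.2]
  have hle : ‖(pushOut h t v).2‖ < 4 * h := by
    rw [hnorm]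
    calc (1 + t * (pushFactor h v - 1)) * ‖v.2‖ ≤ pushFactor h v * ‖v.2‖ := by
          gcongr
      _ ≤ max ‖v.2‖ h := pushFactor_mul_norm_le hh h0
      _ < 4 * h := max_lt h2 (by linarith)
  refine (mem_arch hh).2 ⟨mem_halfBox.2 ⟨h0, h1, hle⟩, ?_⟩
  rcases hc with ⟨ha, hw⟩ | hw | ha
  · refine Or.inl ⟨ha, ?_⟩
    show (1 + t * (pushFactor h v - 1)) • v.2 ≠ 0
    exact smul_ne_zero (by linarith) hw
  · exact Or.inr (Or.inl (hw.trans hge))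
  · exact Or.inr (Or.inr ha)

/-- At time `1` the outward push lands in `T₁`. [folklore] -/
lemma pushOut_one_mem_arch₁ {h : ℝ} (hh : 0 < h) {v : ℝ × F} (hv : v ∈ arch h) :
    pushOut h 1 v ∈ arch₁ h := by
  have hv1 := pushOut_mem_arch hh zero_le_one le_rfl hv
  refine ⟨arch_subset_halfBox hv1, ?_⟩
  obtain ⟨hvb, hc⟩ := (mem_arch hh).1 hv
  rcases hc with ⟨ha, hw⟩ | hw | ha
  · by_cases hwh : h ≤ ‖v.2‖
    · left
      rw [norm_pushOut_snd zero_le_one]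
      nlinarith [one_le_pushFactor h v, norm_nonneg v.2]
    · left
      rw [norm_pushOut_snd zero_le_one, one_mul, add_sub_cancel,
        pushFactor_mul_norm_of_base ha hw (not_le.1 hwh)]
  · left
    rw [norm_pushOut_snd zero_le_one]
    nlinarith [one_le_pushFactor h v, norm_nonneg v.2]
  · exact Or.inr ha

/-- The outward push is jointly continuous on the arch. [folklore] -/
lemma continuousOn_pushOut {h : ℝ} (hh : 0 < h) :
    ContinuousOn (fun p : ℝ × (ℝ × F) => pushOut h p.1 p.2) (univ ×ˢ arch h) := by
  have hg : ContinuousOn (fun p : ℝ × (ℝ × F) => pushFactor h p.2) (univ ×ˢ arch h) :=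
    (continuousOn_pushFactor hh).comp continuous_snd.continuousOn (fun p hp => hp.2)
  unfold pushOut
  refine ContinuousOn.prodMk (continuous_fst.comp continuous_snd).continuousOn ?_
  refine ContinuousOn.smul ?_ (continuous_snd.comp continuous_snd).continuousOn
  exact continuousOn_const.add (continuous_fst.continuousOn.mul (hg.sub continuousOn_const))

/-- The outward push at time `1`, as a map `T → T₁`. [folklore] -/
def archPush {h : ℝ} (hh : 0 < h) : C(arch (F := F) h, arch₁ (F := F) h) :=
  ⟨fun v => ⟨pushOut h 1 v, pushOut_one_mem_arch₁ hh v.2⟩,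
    (((continuousOn_pushOut hh).comp_continuous (continuous_const.prodMk continuous_subtype_val)
      (fun v => ⟨mem_univ _, v.2⟩))).subtype_mk _⟩

/-- The inclusion `T₁ ↪ T`. [folklore] -/
def archIncl {h : ℝ} (hh : 0 < h) : C(arch₁ (F := F) h, arch (F := F) h) :=
  ⟨fun v => ⟨v, arch₁_subset_arch hh v.2⟩, continuous_subtype_val.subtype_mk _⟩

/-- The outward push at time `1` restricts to the identity of `T₁`. [folklore] -/
lemma archPush_comp_archIncl {h : ℝ} (hh : 0 < h) :
    (archPush (F := F) hh).comp (archIncl hh) = ContinuousMap.id _ := by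
  ext1 v
  ext1
  exact pushOut_eq_self_of_mem_arch₁ hh 1 v.2

/-- The arch `T` is homotopy equivalent to `T₁` (push outwards). [folklore] -/
def archEquiv {h : ℝ} (hh : 0 < h) :
    ContinuousMap.HomotopyEquiv (arch (F := F) h) (arch₁ (F := F) h) where
  toFun := archPush hh
  invFun := archIncl hh
  left_inv :=
    ⟨{ toFun := fun p => ⟨pushOut h (1 - p.1) p.2,
          pushOut_mem_arch hh (by linarith [p.1.2.2]) (by linarith [p.1.2.1]) p.2.2⟩
       continuous_toFun := ((continuousOn_pushOut hh).comp_continuous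
          ((continuous_const.sub (continuous_induced_dom.comp continuous_fst)).prodMk
            (continuous_subtype_val.comp continuous_snd)) (fun p => ⟨mem_univ _, p.2.2⟩)).subtype_mk _
       map_zero_left := fun v => by ext1; simp [archPush, archIncl]
       map_one_left := fun v => by ext1; simp [pushOut_zero] }⟩
  right_inv := by
    rw [archPush_comp_archIncl]

/-- **The punctured arch `halfBox (4h) ∖ (ball (h,0) h ∪ {0})` is contractible.** [folklore] -/
theorem contractibleSpace_arch {h : ℝ} (hh : 0 < h) : ContractibleSpace (arch (F := F) h) :=
  haveI : ContractibleSpace (arch₂ (F := F) h) :=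
    ((convex_halfBox_aux : Convex ℝ (arch₂ (F := F) h))).contractibleSpace ⟨_, mem_arch₂_of hh⟩
  haveI : ContractibleSpace (arch₁ (F := F) h) := (archOneEquiv h).contractibleSpace
  (archEquiv hh).contractibleSpace
where
  convex_halfBox_aux : Convex ℝ (arch₂ (F := F) h) :=
    ((convex_halfSpace_ge (LinearMap.fst ℝ ℝ F).isLinear 0).inter (convex_ball 0 (4 * h))).inter
      (convex_halfSpace_ge (LinearMap.fst ℝ ℝ F).isLinear (2 * h))

/-- The half-box is convex. [folklore] -/
lemma convex_halfBox (H : ℝ) : Convex ℝ (halfBox (F := F) H) :=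
  (convex_halfSpace_ge (LinearMap.fst ℝ ℝ F).isLinear 0).inter (convex_ball 0 H)

/-- The half-box is contractible (convex and non-empty). [folklore] -/
theorem contractibleSpace_halfBox {H : ℝ} (hH : 0 < H) : ContractibleSpace (halfBox (F := F) H) :=
  (convex_halfBox H).contractibleSpace ⟨0, zero_mem_halfBox hH⟩

/-- The model `halfBox (4h) ∖ ball (h,0) h` (the arch together with the boundary point `0`) is
path connected when `F` is nontrivial: `0` is joined to the arch along the boundary. [folklore] -/
theorem isPathConnected_halfBox_diff_ball [Nontrivial F] {h : ℝ} (hh : 0 < h) :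
    IsPathConnected (halfBox (4 * h) \ ball ((h, 0) : ℝ × F) h) := by
  -- a nonzero vector of small norm in `F`
  obtain ⟨w₁, hw₁⟩ := exists_ne (0 : F)
  set w₀ : F := (h / ‖w₁‖) • w₁ with hw₀
  have hw₁n : 0 < ‖w₁‖ := norm_pos_iff.2 hw₁
  have hw₀n : ‖w₀‖ = h := by
    rw [hw₀, norm_smul, Real.norm_of_nonneg (div_nonneg hh.le hw₁n.le), div_mul_cancel₀ _ hw₁n.ne']
  have hw₀0 : w₀ ≠ 0 := by
    intro h0; rw [h0, norm_zero] at hw₀n; linarith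
  have hsub : arch (F := F) h ⊆ halfBox (4 * h) \ ball ((h, 0) : ℝ × F) h :=
    sdiff_subset_sdiff_right subset_union_left
  have hx : ((0 : ℝ), w₀) ∈ arch (F := F) h :=
    (mem_arch hh).2 ⟨mem_halfBox.2 ⟨le_rfl, by linarith, by rw [hw₀n]; linarith⟩, Or.inl ⟨rfl, hw₀0⟩⟩
  haveI := contractibleSpace_arch (F := F) hh
  have harch : IsPathConnected (arch (F := F) h) :=
    isPathConnected_iff_pathConnectedSpace.2 inferInstance
  refine ⟨((0 : ℝ), w₀), hsub hx, fun y hy => ?_⟩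
  by_cases hy0 : y = 0
  · -- the boundary segment from `(0, w₀)` to `0`
    subst hy0
    have hseg : ∀ s : ℝ, 0 ≤ s → s ≤ 1 →
        ((0 : ℝ), s • w₀) ∈ halfBox (4 * h) \ ball ((h, 0) : ℝ × F) h := by
      intro s hs0 hs1
      refine ⟨mem_halfBox.2 ⟨le_rfl, by linarith, ?_⟩, fun hb => ?_⟩
      · rw [norm_smul, Real.norm_of_nonneg hs0, hw₀n]; nlinarith
      · exact (lt_irrefl (0 : ℝ)) (mem_ball_boundary.1 hb).1
    refine JoinedIn.symm (JoinedIn.ofLine (f := fun s : ℝ => ((0 : ℝ), s • w₀))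
      ((continuous_const.prodMk (continuous_id.smul continuous_const)).continuousOn) ?_ ?_ ?_)
    · simp
    · simp
    · rintro _ ⟨s, hs, rfl⟩
      exact hseg s hs.1 hs.2
  · exact (harch.joinedIn _ hx y ⟨hy.1, fun h' => h'.elim (fun h₁ => hy.2 h₁) (fun h₂ => hy0 h₂)⟩).mono hsub

end Push

end HalfBall

end Literature.AlgebraicTopology.SingularHomology


/-! ## Part II — The model `EuclideanHalfSpace (n+1)` as the closed half-space of `ℝ × ℝⁿ`, and
boundary points in an arbitrary chart of a `C¹` manifold with boundary -/



open Set Topology Metric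
open scoped Manifold ContDiff

namespace Literature.AlgebraicTopology.SingularHomology

namespace HalfSpaceModel

variable (n : ℕ)

/-- Splitting off the first coordinate: `ℝⁿ⁺¹ ≃ₜ ℝ × ℝⁿ`, `v ↦ (v 0, (v 1, …, v n))`. [folklore] -/
def split : EuclideanSpace ℝ (Fin (n + 1)) ≃ₜ ℝ × EuclideanSpace ℝ (Fin n) where
  toFun v := (v 0, WithLp.toLp 2 (fun i : Fin n => v i.succ))
  invFun q := WithLp.toLp 2 (Fin.cons q.1 (WithLp.ofLp q.2) : Fin (n + 1) → ℝ)
  left_inv v := by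
    ext i
    refine Fin.cases ?_ (fun j => ?_) i
    · simp
    · simp
  right_inv q := by
    ext
    · simp
    · simp
  continuous_toFun := (PiLp.continuous_apply 2 _ 0).prodMk
    ((PiLp.continuous_toLp 2 _).comp (continuous_pi fun i => PiLp.continuous_apply 2 _ i.succ))
  continuous_invFun := (PiLp.continuous_toLp 2 _).comp
    (Continuous.finCons (A := fun _ : Fin (n + 1) => ℝ) continuous_fst
      ((PiLp.continuous_ofLp 2 _).comp continuous_snd))

/-- The coordinate splitting, unfolded. [folklore] -/
lemma split_apply (v : EuclideanSpace ℝ (Fin (n + 1))) :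
    split n v = (v 0, WithLp.toLp 2 (fun i : Fin n => v i.succ)) := rfl

/-- The first component of the splitting is the first coordinate. [folklore] -/
lemma split_apply_fst (v : EuclideanSpace ℝ (Fin (n + 1))) : (split n v).1 = v 0 := rfl

/-- The inverse splitting, unfolded. [folklore] -/
lemma split_symm_apply (q : ℝ × EuclideanSpace ℝ (Fin n)) :
    (split n).symm q = WithLp.toLp 2 (Fin.cons q.1 (WithLp.ofLp q.2) : Fin (n + 1) → ℝ) := rfl

/-- The first coordinate of the inverse splitting. [folklore] -/
lemma split_symm_apply_zero (q : ℝ × EuclideanSpace ℝ (Fin n)) : (split n).symm q 0 = q.1 := by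
  rw [split_symm_apply]; rfl

/-- The half-space `EuclideanHalfSpace (n+1)` as the closed half-space `{0 ≤ a}` of `ℝ × ℝⁿ`: a
partial equivalence with source `univ` and target `{0 ≤ a}`, continuous in both directions
(the inverse folds `a ↦ max a 0`). [folklore] -/
def halfSpaceEquiv : PartialEquiv (EuclideanHalfSpace (n + 1)) (ℝ × EuclideanSpace ℝ (Fin n)) where
  toFun q := split n q.1
  invFun v := ⟨(split n).symm (max v.1 0, v.2), by rw [split_symm_apply_zero]; exact le_max_right _ _⟩
  source := univ
  target := {v | 0 ≤ v.1}
  map_source' q _ := by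
    show 0 ≤ (split n q.1).1
    rw [split_apply_fst]
    exact q.2
  map_target' _ _ := mem_univ _
  left_inv' q _ := by
    apply Subtype.ext
    show (split n).symm (max (split n q.1).1 0, (split n q.1).2) = q.1
    rw [split_apply_fst, max_eq_left q.2]
    conv_rhs => rw [← (split n).symm_apply_apply q.1]
    rfl
  right_inv' v hv := by
    show split n ((split n).symm (max v.1 0, v.2)) = v
    rw [(split n).apply_symm_apply, max_eq_left (show 0 ≤ v.1 from hv)]

/-- The half-space equivalence is the splitting of the underlying vector. [folklore] -/
lemma halfSpaceEquiv_apply (q : EuclideanHalfSpace (n + 1)) : halfSpaceEquiv n q = split n q.1 := rfl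

/-- The half-space equivalence has source `univ`. [folklore] -/
lemma halfSpaceEquiv_source : (halfSpaceEquiv n).source = univ := rfl

/-- The half-space equivalence has target the closed half-space `{0 ≤ a}`. [folklore] -/
lemma halfSpaceEquiv_target : (halfSpaceEquiv n).target = {v | 0 ≤ v.1} := rfl

/-- The half-space equivalence is continuous. [folklore] -/
lemma continuous_halfSpaceEquiv : Continuous (halfSpaceEquiv n) :=
  (split n).continuous.comp continuous_subtype_val

/-- The inverse half-space equivalence (folding `a ↦ max a 0`) is continuous. [folklore] -/
lemma continuous_halfSpaceEquiv_symm : Continuous (halfSpaceEquiv n).symm := by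
  show Continuous fun v : ℝ × EuclideanSpace ℝ (Fin n) =>
    (⟨(split n).symm (max v.1 0, v.2), _⟩ : EuclideanHalfSpace (n + 1))
  exact ((split n).symm.continuous.comp ((continuous_fst.max continuous_const).prodMk continuous_snd)).subtype_mk _

/-- The first component of the half-space equivalence is the first coordinate. [folklore] -/
lemma halfSpaceEquiv_apply_fst (q : EuclideanHalfSpace (n + 1)) : (halfSpaceEquiv n q).1 = q.1 0 :=
  split_apply_fst n q.1

end HalfSpaceModel

/-! ### Boundary points in an arbitrary chart of a `C¹` manifold with boundary -/

section Boundary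

variable {n : ℕ} {X : Type*} [TopologicalSpace X] [ChartedSpace (EuclideanHalfSpace (n + 1)) X]
  {m : WithTop ℕ∞} [IsManifold (𝓡∂ (n + 1)) m X]

/-- **Boundary points in any chart** (chart independence on `C¹` manifolds with boundary, Mathlib's
`ModelWithCorners.isBoundaryPoint_iff_of_mem_atlas`, made explicit for the half-space model): for
a chart `φ` of the atlas and `x ∈ φ.source`, `x ∈ ∂X` iff the first coordinate of `φ x` vanishes. [folklore] -/
theorem mem_boundary_iff_apply_zero_eq (hm : m ≠ 0) {φ : OpenPartialHomeomorph X (EuclideanHalfSpace (n + 1))}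
    (hφ : φ ∈ atlas (EuclideanHalfSpace (n + 1)) X) {x : X} (hx : x ∈ φ.source) :
    x ∈ (𝓡∂ (n + 1)).boundary X ↔ (φ x).1 0 = 0 := by
  have key : (𝓡∂ (n + 1)).IsInteriorPoint x ↔ 0 < (φ x).1 0 := by
    rw [(𝓡∂ (n + 1)).isInteriorPoint_iff_of_mem_atlas hm hφ hx]
    have hext : φ.extend (𝓡∂ (n + 1)) x = (φ x).1 := rfl
    rw [hext, φ.extend_target]
    constructor
    · intro h
      have h' : (φ x).1 ∈ interior (range (𝓡∂ (n + 1))) := interior_mono inter_subset_right h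
      rw [interior_range_modelWithCornersEuclideanHalfSpace] at h'
      exact h'
    · intro h
      rw [mem_interior_iff_mem_nhds]
      have hO : IsOpen ({z : EuclideanSpace ℝ (Fin (n + 1)) | 0 < z 0} ∩
          (𝓡∂ (n + 1)).symm ⁻¹' φ.target) :=
        (isOpen_lt continuous_const (PiLp.continuous_apply 2 _ 0)).inter
          ((𝓡∂ (n + 1)).continuous_symm.isOpen_preimage _ φ.open_target)
      refine Filter.mem_of_superset (hO.mem_nhds ⟨h, ?_⟩) ?_
      · show (𝓡∂ (n + 1)).symm (φ x).1 ∈ φ.target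
        rw [show (φ x).1 = (𝓡∂ (n + 1)) (φ x) from rfl, (𝓡∂ (n + 1)).left_inv]
        exact φ.map_source hx
      · rintro z ⟨hz0, hzt⟩
        refine ⟨hzt, ?_⟩
        rw [range_modelWithCornersEuclideanHalfSpace]
        have hz0' : 0 < z 0 := hz0
        exact hz0'.le
  rw [← (𝓡∂ (n + 1)).compl_interior, mem_compl_iff]
  change ¬ (𝓡∂ (n + 1)).IsInteriorPoint x ↔ _
  rw [key, not_lt]
  exact ⟨fun h => le_antisymm h (φ x).2, fun h => h.le⟩

end Boundary

end Literature.AlgebraicTopology.SingularHomology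


/-! ## Part III — Three criteria from the long exact sequence of a pair with contractible pieces;
excision for local homology at a set; generators along isomorphisms -/



open CategoryTheory Limits Set Topology


namespace Literature.AlgebraicTopology.SingularHomology

variable (R : Type v) [CommRing R] (M : Type v) [AddCommGroup M] [Module R M]
variable {X : Type u} [TopologicalSpace X]

/-! ### Vanishing of local homology at a set with contractible complement -/

/-- **`Hₖ(X | K; M) = 0` for all `k` when `X` and `X ∖ K` are contractible** (long exact sequence of
the pair `(X, X ∖ K)`, Hatcher 2002, §2.1 Thm. 2.13 ff.: `Hₖ(X) = 0 = Hₖ(X ∖ K)` in positive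
degrees, `H₀(X ∖ K) → H₀(X)` an isomorphism). [folklore] -/
theorem isZero_localHomologyOfSet_of_contractibleSpace [ContractibleSpace X] (K : Set X)
    [ContractibleSpace ↥Kᶜ] (k : ℕ) : IsZero (localHomologyOfSet R M X K k) := by
  have hX : ∀ i, i ≠ 0 → IsZero (singularHomology R M X i) := fun i hi =>
    isZero_singularHomology_of_contractibleSpace R M hi
  rcases k with _ | k
  · have hne : (Kᶜ : Set X).Nonempty := Set.nonempty_coe_sort.1 (inferInstance : Nonempty ↥Kᶜ)
    exact isZero_relativeSingularHomology_zero_of_pathConnectedSpace R M _ hne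
  · have hmono : Mono (relativeSingularHomology.δ R M X Kᶜ k) :=
      (relativeSingularHomology.exact_ofAbsolute_δ R M (X := X) Kᶜ k).mono_g
        ((hX (k + 1) (Nat.succ_ne_zero k)).eq_of_src _ _)
    rcases k with _ | k
    · haveI := singularHomology.mono_map_zero_of_pathConnectedSpace R M (subsetIncl (Kᶜ : Set X))
      have hzero : relativeSingularHomology.δ R M X Kᶜ 0 = 0 := by
        rw [← cancel_mono (singularHomology.map R M (subsetIncl (Kᶜ : Set X)) 0),
          relativeSingularHomology.δ_comp_map, zero_comp]
      exact IsZero.of_mono_eq_zero _ hzero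
    · exact IsZero.of_mono (relativeSingularHomology.δ R M X Kᶜ (k + 1))
        (isZero_singularHomology_of_contractibleSpace R M (X := ↥Kᶜ) (Nat.succ_ne_zero k))

/-! ### The connecting homomorphism of a pair with contractible total space -/

/-- **`∂ : Hₙ₊₁(X, A; M) → Hₙ(A; M)` is an isomorphism for `X` contractible and `n ≥ 1`** (long
exact sequence of the pair, Hatcher 2002, §2.1 Thm. 2.13 ff.: `Hₙ₊₁(X) = 0 = Hₙ(X)`). [folklore] -/
theorem isIso_δ_of_contractibleSpace [ContractibleSpace X] (A : Set X) {n : ℕ} (hn : n ≠ 0) :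
    IsIso (relativeSingularHomology.δ R M X A n) := by
  have hmono : Mono (relativeSingularHomology.δ R M X A n) :=
    (relativeSingularHomology.exact_ofAbsolute_δ R M (X := X) A n).mono_g
      ((isZero_singularHomology_of_contractibleSpace R M (X := X) (Nat.succ_ne_zero n)).eq_of_src _ _)
  have hepi : Epi (relativeSingularHomology.δ R M X A n) :=
    (relativeSingularHomology.exact_δ_map R M (X := X) A n).epi_f
      ((isZero_singularHomology_of_contractibleSpace R M (X := X) hn).eq_of_tgt _ _)
  exact isIso_of_mono_of_epi _

/-! ### `Hₙ(S) → Hₙ(S | p)` for a point with contractible complement -/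

/-- **`Hₙ(S; M) → Hₙ(S | p; M)` is an isomorphism for `n ≥ 1` when `S ∖ {p}` is contractible and
`S` is path connected** (long exact sequence of the pair `(S, S ∖ p)`: `Hₙ(S ∖ p) = 0`, and
`Hₙ₋₁(S ∖ p) → Hₙ₋₁(S)` is injective — zero source for `n ≥ 2`, an isomorphism of `H₀`'s for
`n = 1`; Hatcher 2002, §3.3 p. 236, as for `Sⁿ`). [folklore] -/
theorem isIso_toLocal_of_contractibleSpace_compl {S : Type u} [TopologicalSpace S]
    [PathConnectedSpace S] (p : S) [ContractibleSpace ↥(({p}ᶜ : Set S))] {n : ℕ} (hn : n ≠ 0) :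
    IsIso (singularHomology.toLocal R M p n) := by
  obtain ⟨m, rfl⟩ : ∃ m, n = m + 1 := ⟨n - 1, by omega⟩
  set A : Set S := {p}ᶜ with hA
  change IsIso (relativeSingularHomology.ofAbsolute R M S A (m + 1))
  have hmono : Mono (relativeSingularHomology.ofAbsolute R M S A (m + 1)) :=
    (relativeSingularHomology.exact_map_ofAbsolute R M A (m + 1)).mono_g
      ((isZero_singularHomology_of_contractibleSpace R M (X := A) (Nat.succ_ne_zero m)).eq_of_src _ _)
  have hι : Mono (singularHomology.map R M (⟨Subtype.val, continuous_subtype_val⟩ : C(A, S)) m) := by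
    rcases Nat.eq_zero_or_pos m with hm | hm
    · subst hm
      haveI := singularHomology.isIso_map_zero_of_pathConnectedSpace R M
        (⟨Subtype.val, continuous_subtype_val⟩ : C(A, S))
      infer_instance
    · exact ⟨fun _ _ _ =>
        (isZero_singularHomology_of_contractibleSpace R M (X := A) hm.ne').eq_of_tgt _ _⟩
  have hδ : relativeSingularHomology.δ R M S A m = 0 := by
    rw [← cancel_mono (singularHomology.map R M
      (⟨Subtype.val, continuous_subtype_val⟩ : C(A, S)) m), zero_comp,
      relativeSingularHomology.δ_comp_map]
  have hepi : Epi (relativeSingularHomology.ofAbsolute R M S A (m + 1)) :=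
    (relativeSingularHomology.exact_ofAbsolute_δ R M A m).epi_f hδ
  exact isIso_of_mono_of_epi _

/-! ### Excision for local homology at a set -/

namespace localHomologyOfSet

/-- The inclusion of a subspace `O` as a map of pairs `(O, O ∖ K) → (X, X ∖ K)`. [folklore] -/
lemma mapsTo_subsetIncl_compl (O K : Set X) :
    Set.MapsTo (subsetIncl O) ((Subtype.val ⁻¹' K)ᶜ : Set O) (Kᶜ : Set X) := by
  intro y hy h
  exact hy h

/-- **Excision for local homology at a set** (Hatcher 2002, Thm. 2.20 / §3.3 p. 231): for `O`
open with `closure K ⊆ O`, the inclusion `(O, O ∖ K) ↪ (X, X ∖ K)` induces isomorphisms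
`Hₖ(O | K; M) ≅ Hₖ(X | K; M)` (the interiors of `X ∖ K` and `O` cover `X`). [cite: Hatcher2002, Thm. 2.20] -/
theorem isIso_map_subsetIncl_of_closure_subset {O K : Set X} (hO : IsOpen O)
    (hK : closure K ⊆ O) (k : ℕ) :
    IsIso (relativeSingularHomology.map R M (subsetIncl O)
      (mapsTo_subsetIncl_compl O K) k) := by
  have hcov : interior (Kᶜ : Set X) ∪ interior O = Set.univ := by
    rw [hO.interior_eq, interior_compl]
    exact Set.eq_univ_of_forall fun y => (em (y ∈ closure K)).elim (fun hy => Or.inr (hK hy)) Or.inl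
  exact relativeSingularHomology.isIso_map_of_interior_union_interior_holds R M X Kᶜ O hcov k

/-- `Hₖ(O | K; M) ≅ Hₖ(X | K; M)` for `O` open with `closure K ⊆ O`, as an isomorphism
(Hatcher 2002, Thm. 2.20). [cite: Hatcher2002, Thm. 2.20] -/
def openSubsetIso {O K : Set X} (hO : IsOpen O) (hK : closure K ⊆ O) (k : ℕ) :
    localHomologyOfSet R M (↥O) (Subtype.val ⁻¹' K) k ≅ localHomologyOfSet R M X K k :=
  haveI := isIso_map_subsetIncl_of_closure_subset R M hO hK k
  asIso (relativeSingularHomology.map R M (subsetIncl O)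
    (mapsTo_subsetIncl_compl O K) k)

end localHomologyOfSet

/-! ### Generators of rank-one modules along isomorphisms -/

/-- Generators (elements sent to `1` by some linear isomorphism onto `R`) are preserved and
reflected by isomorphisms of `R`-modules. [folklore] -/
lemma isGenerator_iff_of_isIso {V W : ModuleCat.{u} R} (f : V ⟶ W) [IsIso f] (x : V) :
    (∃ e : W ≃ₗ[R] R, e (f x) = 1) ↔ ∃ e : V ≃ₗ[R] R, e x = 1 := by
  constructor
  · rintro ⟨e, he⟩
    exact ⟨(asIso f).toLinearEquiv.trans e, he⟩
  · rintro ⟨e, he⟩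
    refine ⟨(asIso f).toLinearEquiv.symm.trans e, ?_⟩
    rw [LinearEquiv.trans_apply, show f x = (asIso f).toLinearEquiv x from rfl,
      LinearEquiv.symm_apply_apply, he]

end Literature.AlgebraicTopology.SingularHomology


/-! ## Part IV — Star-convex chart pieces for partial charts with non-open target -/



open CategoryTheory Limits Topology Metric Set


namespace Literature.AlgebraicTopology.SingularHomology

variable (R : Type v) [CommRing R] (M : Type v) [AddCommGroup M] [Module R M]
variable {X : Type u} [TopologicalSpace X]

open unitInterval

section Chart

variable [T2Space X] {E : Type*} [NormedAddCommGroup E] [NormedSpace ℝ E] [ProperSpace E]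

/-- **Star-convex pieces of a partial chart.** Let `e : PartialEquiv X E` have open source and be
continuous in both directions (on its source, resp. target — the target need not be open), `q` a
point with `closedBall q ρ ⊆ e.target` (`ρ > 0`), and `C` star-convex about `q ∈ C`. Then for
`K = e⁻¹ C ⊆ B = e⁻¹(ball q ρ)` (preimages within `e.source`) the restriction
`Hᵢ(X | B; M) ⟶ Hᵢ(X | K; M)` is an isomorphism for all `i` (radial push-out from `q` beyond
radius `ρ`, Hatcher 2002, §3.3, proof of Lemma 3.27, step (3), p. 237, and p. 234).
[cite: Hatcher2002, §3.3 proof of Lemma 3.27 step (3) p. 237] -/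
theorem isIso_restrictLocal_of_starConvex_partialEquiv (e : PartialEquiv X E)
    (hes : IsOpen e.source) (hec : ContinuousOn e e.source) (hec' : ContinuousOn e.symm e.target)
    {q : E} {ρ : ℝ} (hρ : 0 < ρ) (hρt : closedBall q ρ ⊆ e.target) {C : Set E}
    (hC : StarConvex ℝ q C) (hqC : q ∈ C) {K B : Set X} (hK : K = e.source ∩ e ⁻¹' C)
    (hB : B = e.source ∩ e ⁻¹' ball q ρ) (hKB : K ⊆ B) (i : ℕ) :
    IsIso (restrictLocal R M hKB i) := by
  subst hK hB
  classical
  have hqt : q ∈ e.target := hρt (mem_closedBall_self hρ.le)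
  set x₀ : X := e.symm q with hx₀
  have hx₀s : x₀ ∈ e.source := e.map_target hqt
  have hcx₀ : e x₀ = q := e.right_inv hqt
  set D : Set X := e.source ∩ e ⁻¹' closedBall q ρ with hD
  have hDc : IsClosed D := by
    rw [hD, ← e.symm_image_eq_source_inter_preimage hρt]
    exact ((isCompact_closedBall q ρ).image_of_continuousOn (hec'.mono hρt)).isClosed
  have hBo : IsOpen (e.source ∩ e ⁻¹' ball q ρ) := hec.isOpen_inter_preimage hes isOpen_ball
  have hBD : e.source ∩ e ⁻¹' ball q ρ ⊆ D := fun y hy ↦ ⟨hy.1, ball_subset_closedBall hy.2⟩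
  have hx₀K : x₀ ∈ e.source ∩ e ⁻¹' C := ⟨hx₀s, by rw [mem_preimage, hcx₀]; exact hqC⟩
  have hne : ∀ y ∈ D, y ≠ x₀ → e y ≠ q := fun y hy hyx h ↦
    hyx (e.injOn hy.1 hx₀s (h.trans hcx₀.symm))
  have hnorm : ∀ y ∈ D, ‖e y - q‖ ≤ ρ := fun y hy ↦ by rw [← dist_eq_norm]; exact hy.2
  have hsphere : ∀ y ∈ D, y ∉ e.source ∩ e ⁻¹' ball q ρ → ‖e y - q‖ = ρ := fun y hy hyB ↦
    le_antisymm (hnorm y hy) (by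
      rw [← dist_eq_norm]; exact not_lt.1 fun h ↦ hyB ⟨hy.1, h⟩)
  -- the push-out coefficient `μ t v = (1 - t) max(1, ρ/‖v - q‖) + t ≥ 1` and map `P t v`
  let μ : ℝ → E → ℝ := fun t v ↦ (1 - t) * max 1 (ρ / ‖v - q‖) + t
  let P : ℝ → E → E := fun t v ↦ q + μ t v • (v - q)
  have one_le_μ : ∀ {t : ℝ}, 0 ≤ t → t ≤ 1 → ∀ v, 1 ≤ μ t v := fun {t} ht0 ht1 v ↦ by
    have h1 : (0 : ℝ) ≤ 1 - t := by linarith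
    show 1 ≤ (1 - t) * max 1 (ρ / ‖v - q‖) + t
    nlinarith [le_max_left (1 : ℝ) (ρ / ‖v - q‖)]
  have μ_of_le : ∀ (t : ℝ) {v : E}, v ≠ q → ‖v - q‖ ≤ ρ →
      μ t v * ‖v - q‖ = (1 - t) * ρ + t * ‖v - q‖ := fun t {v} hv hvρ ↦ by
    have hd : 0 < ‖v - q‖ := norm_pos_iff.2 (sub_ne_zero.2 hv)
    have hmax : max 1 (ρ / ‖v - q‖) = ρ / ‖v - q‖ :=
      max_eq_right ((one_le_div hd).2 hvρ)
    show ((1 - t) * max 1 (ρ / ‖v - q‖) + t) * ‖v - q‖ = _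
    rw [hmax, add_mul, mul_assoc, div_mul_cancel₀ _ hd.ne']
  have norm_P : ∀ {t : ℝ}, 0 ≤ t → t ≤ 1 → ∀ {v : E}, v ≠ q → ‖v - q‖ ≤ ρ →
      ‖P t v - q‖ = (1 - t) * ρ + t * ‖v - q‖ := fun {t} ht0 ht1 {v} hv hvρ ↦ by
    show ‖q + μ t v • (v - q) - q‖ = _
    rw [add_sub_cancel_left, norm_smul,
      Real.norm_of_nonneg (zero_le_one.trans (one_le_μ ht0 ht1 v)), μ_of_le t hv hvρ]
  have P_mem : ∀ {t : ℝ}, 0 ≤ t → t ≤ 1 → ∀ {v : E}, v ≠ q → ‖v - q‖ ≤ ρ →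
      P t v ∈ closedBall q ρ := fun {t} ht0 ht1 {v} hv hvρ ↦ by
    rw [mem_closedBall, dist_eq_norm, norm_P ht0 ht1 hv hvρ]
    nlinarith
  have P_of_eq : ∀ (t : ℝ) {v : E}, ‖v - q‖ = ρ → P t v = v := fun t {v} hv ↦ by
    show q + ((1 - t) * max 1 (ρ / ‖v - q‖) + t) • (v - q) = v
    rw [hv, div_self hρ.ne', max_self, mul_one, sub_add_cancel, one_smul, add_sub_cancel]
  have P_one : ∀ v : E, P 1 v = v := fun v ↦ by
    show q + ((1 - 1) * max 1 (ρ / ‖v - q‖) + 1) • (v - q) = v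
    rw [sub_self, zero_mul, zero_add, one_smul, add_sub_cancel]
  have P_not_mem : ∀ {t : ℝ}, 0 ≤ t → t ≤ 1 → ∀ {v : E}, v ∉ C → P t v ∉ C :=
    fun {t} ht0 ht1 {v} hv h ↦ hv (mem_of_one_le_of_add_smul_sub_mem hC (one_le_μ ht0 ht1 v) h)
  have P_zero_not_mem : ∀ {v : E}, v ≠ q → ‖v - q‖ ≤ ρ → P 0 v ∉ ball q ρ := by
    intro v hv hvρ h
    rw [mem_ball, dist_eq_norm, norm_P le_rfl zero_le_one hv hvρ] at h
    linarith
  have hPc : ContinuousOn (fun z : ℝ × E ↦ P z.1 z.2) {z | z.2 ≠ q} := by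
    have hs : Continuous (fun z : ℝ × E ↦ z.1) := continuous_fst
    have hcoef : ContinuousOn (fun z : ℝ × E ↦ μ z.1 z.2) {z : ℝ × E | z.2 ≠ q} := by
      refine (((continuous_const.sub hs).continuousOn).mul (continuous_max.comp_continuousOn
        (continuousOn_const.prodMk (continuousOn_const.div ?_ fun p hp ↦ ?_)))).add hs.continuousOn
      · fun_prop
      · rw [norm_ne_zero_iff, sub_ne_zero]
        exact hp
    exact continuousOn_const.add (hcoef.smul (by fun_prop))
  -- the deformation of `X ∖ K` onto `X ∖ B`, transported by the chart
  let F : I × X → X := fun z ↦ if z.2 ∈ D then e.symm (P z.1 (e z.2)) else z.2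
  have hFD : ∀ (t : I) (y : X), y ∈ D → F (t, y) = e.symm (P t (e y)) := fun t y hy ↦ if_pos hy
  have hFD' : ∀ (t : I) (y : X), y ∉ D → F (t, y) = y := fun t y hy ↦ if_neg hy
  have hmem : ∀ (t : I), ∀ y ∈ D, y ≠ x₀ → P t (e y) ∈ closedBall q ρ := fun t y hy hyx ↦
    P_mem t.2.1 t.2.2 (hne y hy hyx) (hnorm y hy)
  -- `F` preserves the complement of `K`
  have hFK : ∀ (t : I) (y : X), y ∉ e.source ∩ e ⁻¹' C → F (t, y) ∉ e.source ∩ e ⁻¹' C := by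
    intro t y hyK
    by_cases hy : y ∈ D
    · have hyx : y ≠ x₀ := fun h ↦ hyK (h ▸ hx₀K)
      rw [hFD t y hy]
      rintro ⟨-, h⟩
      rw [mem_preimage, e.right_inv (hρt (hmem t y hy hyx))] at h
      exact P_not_mem t.2.1 t.2.2 (fun h' ↦ hyK ⟨hy.1, h'⟩) h
    · rwa [hFD' t y hy]
  -- at time `0`, `F` lands outside `B`
  have hF0 : ∀ y : X, y ∉ e.source ∩ e ⁻¹' C → F (0, y) ∉ e.source ∩ e ⁻¹' ball q ρ := by
    intro y hyK
    by_cases hy : y ∈ D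
    · have hyx : y ≠ x₀ := fun h ↦ hyK (h ▸ hx₀K)
      rw [hFD 0 y hy]
      rintro ⟨-, h⟩
      rw [mem_preimage, e.right_inv (hρt (hmem 0 y hy hyx))] at h
      exact P_zero_not_mem (hne y hy hyx) (hnorm y hy) h
    · rw [hFD' 0 y hy]
      exact fun h ↦ hy (hBD h)
  -- at time `0`, `F` fixes the complement of `B`
  have hF0' : ∀ y : X, y ∉ e.source ∩ e ⁻¹' ball q ρ → F (0, y) = y := by
    intro y hyB
    by_cases hy : y ∈ D
    · rw [hFD 0 y hy, P_of_eq _ (hsphere y hy hyB), e.left_inv hy.1]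
    · exact hFD' 0 y hy
  have hF1 : ∀ y : X, F (1, y) = y := by
    intro y
    by_cases hy : y ∈ D
    · rw [hFD 1 y hy, Set.Icc.coe_one, P_one, e.left_inv hy.1]
    · exact hFD' 1 y hy
  have hFc : ContinuousOn F {z | z.2 ≠ x₀} := by
    apply ContinuousOn.if
    · rintro ⟨t, y⟩ ⟨hyx : y ≠ x₀, hfr⟩
      have hyD : y ∈ D := frontier_subset_iff_isClosed.2 (hDc.preimage continuous_snd) hfr
      have hyB : y ∉ e.source ∩ e ⁻¹' ball q ρ := fun h ↦
        hfr.2 (interior_maximal (s := {a : I × X | a.2 ∈ D})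
          (t := Prod.snd ⁻¹' (e.source ∩ e ⁻¹' ball q ρ))
          (fun z hz ↦ hBD hz) (hBo.preimage continuous_snd) h)
      simp only
      rw [P_of_eq _ (hsphere y hyD hyB), e.left_inv hyD.1]
    · have hcl : closure {a : I × X | a.2 ∈ D} = {a | a.2 ∈ D} :=
        (hDc.preimage continuous_snd).closure_eq
      rw [hcl]
      refine hec'.comp (hPc.comp
        ((continuous_subtype_val.comp continuous_fst).continuousOn.prodMk
          (hec.comp continuousOn_snd fun z hz ↦ hz.2.1)) ?_) ?_
      · exact fun z hz ↦ hne z.2 hz.2 hz.1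
      · exact fun z hz ↦ hρt (hmem z.1 z.2 hz.2 hz.1)
    · exact continuousOn_snd
  -- assemble the retraction and the homotopy
  have hKx : ∀ y : X, y ∉ e.source ∩ e ⁻¹' C → y ≠ x₀ := fun y hy h ↦ hy (h ▸ hx₀K)
  let r : C(((e.source ∩ e ⁻¹' C)ᶜ : Set X), ((e.source ∩ e ⁻¹' ball q ρ)ᶜ : Set X)) :=
    ⟨fun y ↦ ⟨F (0, y), hF0 y y.2⟩,
      (hFc.comp_continuous (continuous_const.prodMk continuous_subtype_val)
        fun y ↦ by exact hKx _ y.2).subtype_mk _⟩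
  refine isIso_restrictLocal_of_retract R M hKB r
    (ContinuousMap.ext fun y ↦ Subtype.ext (hF0' y y.2)) ⟨?_⟩ i
  exact
    { toFun := fun z ↦ ⟨F (z.1, z.2), hFK z.1 z.2 z.2.2⟩
      continuous_toFun := (hFc.comp_continuous
        (continuous_fst.prodMk (continuous_subtype_val.comp continuous_snd))
        fun z ↦ by exact hKx _ z.2.2).subtype_mk _
      map_zero_left := fun y ↦ rfl
      map_one_left := fun y ↦ Subtype.ext (hF1 y) }

/-- **Restriction to the centre of a star-convex partial-chart piece is an isomorphism.** With
`e`, `ρ` as above, `x ∈ e.source`, and `C ⊆ ball (e x) ρ` star-convex about `e x ∈ C`, the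
restriction `Hᵢ(X | e⁻¹ C; M) ⟶ Hᵢ(X | x; M)` is an isomorphism for all `i` (Hatcher 2002, §3.3,
proof of Lemma 3.27, step (3), p. 237). [cite: Hatcher2002, §3.3 proof of Lemma 3.27 step (3) p. 237] -/
theorem isIso_restrictToPoint_of_starConvex_partialEquiv (e : PartialEquiv X E)
    (hes : IsOpen e.source) (hec : ContinuousOn e e.source) (hec' : ContinuousOn e.symm e.target)
    {x : X} (hx : x ∈ e.source) {ρ : ℝ} (hρ : 0 < ρ) (hρt : closedBall (e x) ρ ⊆ e.target)
    {C : Set E} (hC : StarConvex ℝ (e x) C) (hxC : e x ∈ C) (hCρ : C ⊆ ball (e x) ρ) {K : Set X}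
    (hK : K = e.source ∩ e ⁻¹' C) (hxK : x ∈ K) (i : ℕ) :
    IsIso (restrictToPoint R M hxK i) := by
  set B : Set X := e.source ∩ e ⁻¹' ball (e x) ρ with hB
  have hKB : K ⊆ B := by
    rw [hK]
    exact fun y hy ↦ ⟨hy.1, hCρ hy.2⟩
  haveI h1 : IsIso (restrictLocal R M hKB i) :=
    isIso_restrictLocal_of_starConvex_partialEquiv R M e hes hec hec' hρ hρt hC hxC hK hB hKB i
  have hxB : ({x} : Set X) ⊆ B := singleton_subset_iff.2 (hKB hxK)
  have hx' : ({x} : Set X) = e.source ∩ e ⁻¹' {e x} := by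
    ext y
    simp only [mem_singleton_iff, mem_inter_iff, mem_preimage]
    constructor
    · rintro rfl
      exact ⟨hx, rfl⟩
    · rintro ⟨hy, h⟩
      exact e.injOn hy hx h
  have h2 : IsIso (restrictLocal R M hxB i) :=
    isIso_restrictLocal_of_starConvex_partialEquiv R M e hes hec hec' hρ hρt
      (starConvex_singleton (e x)) (mem_singleton _) hx' hB hxB i
  have hcomp : restrictLocal R M hKB i ≫ restrictToPoint R M hxK i = restrictLocal R M hxB i :=
    restrictLocal_comp R M _ _ i
  haveI : IsIso (restrictLocal R M hKB i ≫ restrictToPoint R M hxK i) := by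
    rw [hcomp]
    exact h2
  exact IsIso.of_isIso_comp_left (restrictLocal R M hKB i) _

end Chart

end Literature.AlgebraicTopology.SingularHomology


/-! ## Part V — Half charts at a boundary point and the transfer of local generators -/



open CategoryTheory Limits Topology Metric Set


namespace Literature.AlgebraicTopology.SingularHomology

variable (R : Type v) [CommRing R] (M : Type v) [AddCommGroup M] [Module R M]
variable {X : Type u} [TopologicalSpace X]

/-! ### Partial charts: homeomorphisms onto model pieces -/

section PartialCharts

variable {Y : Type*} [TopologicalSpace Y]

/-- A partial equivalence, continuous in both directions, restricts to a homeomorphism between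
subsets corresponding to each other.  Declared in the root namespace as a dot-notation extension
of Mathlib's `PartialEquiv` (`e.homeomorphOfMapsTo …`). [folklore] -/
def _root_.PartialEquiv.homeomorphOfMapsTo (e : PartialEquiv X Y) (hc : ContinuousOn e e.source)
    (hc' : ContinuousOn e.symm e.target) {A : Set X} {A' : Set Y} (hA : A ⊆ e.source)
    (hA' : A' ⊆ e.target) (h₁ : MapsTo e A A') (h₂ : MapsTo e.symm A' A) : A ≃ₜ A' where
  toFun := h₁.restrict e A A'
  invFun := h₂.restrict e.symm A' A
  left_inv x := Subtype.ext (e.left_inv (hA x.2))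
  right_inv y := Subtype.ext (e.right_inv (hA' y.2))
  continuous_toFun := (hc.mono hA).mapsToRestrict h₁
  continuous_invFun := (hc'.mono hA').mapsToRestrict h₂

/-- The restricted homeomorphism is the partial equivalence on points (dot-notation extension of
Mathlib's `PartialEquiv`, root namespace). [folklore] -/
@[simp]
lemma _root_.PartialEquiv.homeomorphOfMapsTo_apply_coe (e : PartialEquiv X Y) (hc : ContinuousOn e e.source)
    (hc' : ContinuousOn e.symm e.target) {A : Set X} {A' : Set Y} (hA : A ⊆ e.source)
    (hA' : A' ⊆ e.target) (h₁ : MapsTo e A A') (h₂ : MapsTo e.symm A' A) (x : A) :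
    (e.homeomorphOfMapsTo hc hc' hA hA' h₁ h₂ x : Y) = e x := rfl

end PartialCharts

/-! ### Half charts at a boundary point -/

/-- **A half chart at a boundary point.**  For a subset `B ⊆ X` ("the boundary") and `p ∈ B`: a
partial equivalence `e` from an open neighbourhood of `p` to the closed half-space
`{0 ≤ a} ⊆ ℝ × F` (sup norm), continuous in both directions, with `e p = 0`, whose target contains
the closed half-box of size `4h` and which matches `B` with the hyperplane `{a = 0}` there
(the local model of a topological manifold with boundary `B` near `p`, Hatcher 2002, §3.3
p. 252; scaled so that all constructions below take place inside the box of size `4h`). [folklore] -/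
structure HalfChart (B : Set X) (p : X) (F : Type) [NormedAddCommGroup F] [NormedSpace ℝ F]
    (h : ℝ) where
  /-- The partial chart. -/
  e : PartialEquiv X (ℝ × F)
  isOpen_source : IsOpen e.source
  continuousOn : ContinuousOn e e.source
  continuousOn_symm : ContinuousOn e.symm e.target
  mem_source : p ∈ e.source
  apply_eq_zero : e p = 0
  pos : 0 < h
  target_subset : e.target ⊆ {v | 0 ≤ v.1}
  subset_target : {v : ℝ × F | 0 ≤ v.1} ∩ closedBall 0 (4 * h) ⊆ e.target
  mem_iff : ∀ x ∈ e.source, e x ∈ closedBall (0 : ℝ × F) (4 * h) → (x ∈ B ↔ (e x).1 = 0)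

namespace HalfChart

variable {B : Set X} {p : X} {F : Type} [NormedAddCommGroup F] [NormedSpace ℝ F] {h : ℝ}
variable (c : HalfChart B p F h)

/-- The **core** `N⁺ = e⁻¹ (ball (h,0) h)`: the open sup-ball `(0, 2h) × ball 0 h` of the chart
sitting on the boundary at `p` (it lies in the open half-space, and near `p` it is all of the
complement of `B`). [folklore] -/
def core : Set X := c.e.source ∩ c.e ⁻¹' ball ((h, 0) : ℝ × F) h

/-- The **box** `O = e⁻¹ (ball 0 (4h))`, homeomorphic to the open half-box of size `4h`. [folklore] -/
def box : Set X := c.e.source ∩ c.e ⁻¹' ball (0 : ℝ × F) (4 * h)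

/-- The neighbourhood `V = e⁻¹ ({a < 2h} ∩ {‖w‖ < h})` of `p` on which `X ∖ N⁺` coincides with
`B`. [folklore] -/
def near : Set X := c.e.source ∩ c.e ⁻¹' {v : ℝ × F | v.1 < 2 * h ∧ ‖v.2‖ < h}

/-- The interior base point `y = e⁻¹ (h, 0)` of the core. [folklore] -/
def center : X := c.e.symm ((h, 0) : ℝ × F)

/-- Points of the chart have non-negative first coordinate. [folklore] -/
lemma nonneg_fst {x : X} (hx : x ∈ c.e.source) : 0 ≤ (c.e x).1 :=
  c.target_subset (c.e.map_source hx)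

/-- The core is open. [folklore] -/
lemma isOpen_core : IsOpen c.core := c.continuousOn.isOpen_inter_preimage c.isOpen_source isOpen_ball

/-- The box is open. [folklore] -/
lemma isOpen_box : IsOpen c.box := c.continuousOn.isOpen_inter_preimage c.isOpen_source isOpen_ball

/-- The neighbourhood `V` is open. [folklore] -/
lemma isOpen_near : IsOpen c.near :=
  c.continuousOn.isOpen_inter_preimage c.isOpen_source
    ((isOpen_lt continuous_fst continuous_const).inter
      (isOpen_lt (continuous_norm.comp continuous_snd) continuous_const))

/-- Membership in the core: `0 < a < 2h` and `‖w‖ < h` in the chart. [folklore] -/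
lemma mem_core_iff {x : X} : x ∈ c.core ↔ x ∈ c.e.source ∧ 0 < (c.e x).1 ∧ (c.e x).1 < 2 * h ∧
    ‖(c.e x).2‖ < h := by
  rw [core, mem_inter_iff, mem_preimage, HalfBall.mem_ball_boundary]

/-- The closed sup-ball `[0, 2h] × closedBall 0 h` lies in the target of the chart. [folklore] -/
lemma closedBall_center_subset_target :
    closedBall ((h, 0) : ℝ × F) h ⊆ c.e.target := by
  intro v hv
  rw [mem_closedBall, Prod.dist_eq, max_le_iff, Real.dist_eq, dist_zero_right, abs_sub_le_iff] at hv
  have hpos := c.pos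
  refine c.subset_target ⟨?_, ?_⟩
  · show 0 ≤ v.1
    linarith [hv.1.2]
  · rw [mem_closedBall, dist_zero_right, Prod.norm_def, max_le_iff, Real.norm_eq_abs, abs_le]
    exact ⟨⟨by linarith [hv.1.2], by linarith [hv.1.1]⟩, by linarith [hv.2]⟩

/-- The model centre `(h, 0)` lies in the target. [folklore] -/
lemma center_mem_target : ((h, 0) : ℝ × F) ∈ c.e.target :=
  c.closedBall_center_subset_target (mem_closedBall_self c.pos.le)

/-- The centre `y` lies in the source. [folklore] -/
lemma center_mem_source : c.center ∈ c.e.source := c.e.map_target c.center_mem_target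

/-- The chart sends the centre to `(h, 0)`. [folklore] -/
lemma apply_center : c.e c.center = ((h, 0) : ℝ × F) := c.e.right_inv c.center_mem_target

/-- The centre lies in the core. [folklore] -/
lemma center_mem_core : c.center ∈ c.core :=
  ⟨c.center_mem_source, by rw [mem_preimage, c.apply_center]; exact mem_ball_self c.pos⟩

/-- The core lies in the box. [folklore] -/
lemma core_subset_box : c.core ⊆ c.box := by
  intro x hx
  obtain ⟨hxs, h1, h2, h3⟩ := c.mem_core_iff.1 hx
  refine ⟨hxs, ?_⟩
  rw [mem_preimage, mem_ball, dist_zero_right, Prod.norm_def, max_lt_iff, Real.norm_eq_abs, abs_lt]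
  have hpos := c.pos
  exact ⟨⟨by linarith, by linarith⟩, by linarith⟩

/-- The core lies in `V`. [folklore] -/
lemma core_subset_near : c.core ⊆ c.near := fun _ hx =>
  let ⟨hxs, _, h2, h3⟩ := c.mem_core_iff.1 hx
  ⟨hxs, h2, h3⟩

/-- `p ∈ V`. [folklore] -/
lemma p_mem_near : p ∈ c.near :=
  ⟨c.mem_source, by
    rw [mem_preimage, c.apply_eq_zero]
    have hpos := c.pos
    exact ⟨by simp; linarith, by simp; exact hpos⟩⟩

/-- `p` lies in the box. [folklore] -/
lemma p_mem_box : p ∈ c.box :=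
  ⟨c.mem_source, by rw [mem_preimage, c.apply_eq_zero]; exact mem_ball_self (by linarith [c.pos])⟩

/-- `p` does not lie in the core. [folklore] -/
lemma p_not_mem_core : p ∉ c.core := fun hp => by
  have := (c.mem_core_iff.1 hp).2.1
  rw [c.apply_eq_zero] at this
  exact lt_irrefl _ this

/-- **Local coincidence**: on `V`, the complement of the core is exactly `B`. [folklore] -/
lemma mem_near_diff_core_iff {x : X} (hx : x ∈ c.near) : x ∉ c.core ↔ x ∈ B := by
  obtain ⟨hxs, h2, h3⟩ := hx
  have h0 := c.nonneg_fst hxs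
  have hpos := c.pos
  have hball : c.e x ∈ closedBall (0 : ℝ × F) (4 * h) := by
    rw [mem_closedBall, dist_zero_right, Prod.norm_def, max_le_iff, Real.norm_eq_abs, abs_le]
    exact ⟨⟨by linarith, by linarith⟩, by linarith⟩
  rw [c.mem_iff x hxs hball, c.mem_core_iff]
  constructor
  · intro hn
    by_contra hne
    exact hn ⟨hxs, lt_of_le_of_ne h0 (Ne.symm hne), h2, h3⟩
  · rintro he ⟨-, hlt, -, -⟩
    rw [he] at hlt
    exact lt_irrefl _ hlt

/-- `V ∖ N⁺ = V ∩ B`. [folklore] -/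
lemma near_inter_compl_core : c.near ∩ c.coreᶜ = c.near ∩ B := by
  ext x
  constructor
  · rintro ⟨hx, hxc⟩
    exact ⟨hx, (c.mem_near_diff_core_iff hx).1 hxc⟩
  · rintro ⟨hx, hxB⟩
    exact ⟨hx, (c.mem_near_diff_core_iff hx).2 hxB⟩

/-- `B` misses the core. [folklore] -/
lemma B_subset_compl_core : B ⊆ c.coreᶜ := by
  intro x hxB hxc
  have hx : x ∈ c.near := c.core_subset_near hxc
  exact (c.mem_near_diff_core_iff hx).2 hxB hxc

/-- The closed chart ball `e⁻¹ (closedBall (h,0) h)` is closed in `X`. [folklore] -/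
lemma isClosed_preimage_closedBall [T2Space X] [ProperSpace F] :
    IsClosed (c.e.source ∩ c.e ⁻¹' closedBall ((h, 0) : ℝ × F) h) := by
  rw [← c.e.symm_image_eq_source_inter_preimage c.closedBall_center_subset_target]
  exact ((isCompact_closedBall _ _).image_of_continuousOn
    (c.continuousOn_symm.mono c.closedBall_center_subset_target)).isClosed

/-- The closure of the core lies in the box. [folklore] -/
lemma closure_core_subset_box [T2Space X] [ProperSpace F] : closure c.core ⊆ c.box := by
  have h1 : closure c.core ⊆ c.e.source ∩ c.e ⁻¹' closedBall ((h, 0) : ℝ × F) h :=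
    closure_minimal (fun x hx => ⟨hx.1, ball_subset_closedBall hx.2⟩) c.isClosed_preimage_closedBall
  refine h1.trans fun x hx => ⟨hx.1, ?_⟩
  have hv := hx.2
  rw [mem_preimage, mem_closedBall, Prod.dist_eq, max_le_iff, Real.dist_eq, dist_zero_right,
    abs_sub_le_iff] at hv
  rw [mem_preimage, mem_ball, dist_zero_right, Prod.norm_def, max_lt_iff, Real.norm_eq_abs, abs_lt]
  have hpos := c.pos
  exact ⟨⟨by linarith [hv.1.2], by linarith [hv.1.1]⟩, by linarith [hv.2]⟩

/-! #### The model pieces -/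

/-- The box is homeomorphic to the open half-box `halfBox (4h)`. [folklore] -/
def boxHomeomorph : c.box ≃ₜ HalfBall.halfBox (F := F) (4 * h) :=
  c.e.homeomorphOfMapsTo c.continuousOn c.continuousOn_symm inter_subset_left
    (fun v hv => c.subset_target ⟨hv.1, ball_subset_closedBall hv.2⟩)
    (fun x hx => ⟨c.nonneg_fst hx.1, hx.2⟩)
    (fun v hv => by
      have hvt : v ∈ c.e.target := c.subset_target ⟨hv.1, ball_subset_closedBall hv.2⟩
      exact ⟨c.e.map_target hvt, by rw [mem_preimage, c.e.right_inv hvt]; exact hv.2⟩)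

/-- The box minus the core is homeomorphic to the model `halfBox (4h) ∖ ball (h,0) h`. [folklore] -/
def boxDiffCoreHomeomorph :
    ↥(c.box ∩ c.coreᶜ) ≃ₜ ↥(HalfBall.halfBox (4 * h) \ ball ((h, 0) : ℝ × F) h) :=
  c.e.homeomorphOfMapsTo c.continuousOn c.continuousOn_symm
    (inter_subset_left.trans inter_subset_left)
    (fun v hv => c.subset_target ⟨hv.1.1, ball_subset_closedBall hv.1.2⟩)
    (fun x hx => ⟨⟨c.nonneg_fst hx.1.1, hx.1.2⟩, fun hb => hx.2 ⟨hx.1.1, hb⟩⟩)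
    (fun v hv => by
      have hvt : v ∈ c.e.target := c.subset_target ⟨hv.1.1, ball_subset_closedBall hv.1.2⟩
      have hs := c.e.map_target hvt
      have hev : c.e (c.e.symm v) = v := c.e.right_inv hvt
      exact ⟨⟨hs, by rw [mem_preimage, hev]; exact hv.1.2⟩, fun hc => hv.2 (by
        have := hc.2; rwa [mem_preimage, hev] at this)⟩)

/-- The box minus the core and `p` is homeomorphic to the punctured arch. [folklore] -/
def boxDiffCorePHomeomorph :
    ↥(c.box ∩ c.coreᶜ ∩ {p}ᶜ) ≃ₜ ↥(HalfBall.arch (F := F) h) :=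
  c.e.homeomorphOfMapsTo c.continuousOn c.continuousOn_symm
    ((inter_subset_left.trans inter_subset_left).trans inter_subset_left)
    (fun v hv => c.subset_target ⟨hv.1.1, ball_subset_closedBall hv.1.2⟩)
    (fun x hx => ⟨⟨c.nonneg_fst hx.1.1.1, hx.1.1.2⟩, fun hb => hb.elim (fun hb => hx.1.2 ⟨hx.1.1.1, hb⟩)
      (fun hb => hx.2 (by
        have h0 : c.e x = c.e p := by rw [c.apply_eq_zero]; exact hb
        exact c.e.injOn hx.1.1.1 c.mem_source h0))⟩)
    (fun v hv => by
      have hvt : v ∈ c.e.target := c.subset_target ⟨hv.1.1, ball_subset_closedBall hv.1.2⟩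
      have hs := c.e.map_target hvt
      have hev : c.e (c.e.symm v) = v := c.e.right_inv hvt
      refine ⟨⟨⟨hs, by rw [mem_preimage, hev]; exact hv.1.2⟩, fun hc => hv.2 (Or.inl (by
        have := hc.2; rwa [mem_preimage, hev] at this))⟩, fun hp => hv.2 (Or.inr ?_)⟩
      have : v = c.e p := by rw [← hev, show c.e.symm v = p from hp]
      rw [this, c.apply_eq_zero]
      rfl)

/-- The box is contractible. [folklore] -/
instance contractibleSpace_box : ContractibleSpace c.box :=
  haveI := HalfBall.contractibleSpace_halfBox (F := F) (by linarith [c.pos] : 0 < 4 * h)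
  c.boxHomeomorph.contractibleSpace

/-- The box minus the core and `p` is contractible (punctured arch). [folklore] -/
lemma contractibleSpace_boxDiffCoreP : ContractibleSpace ↥(c.box ∩ c.coreᶜ ∩ {p}ᶜ) :=
  haveI := HalfBall.contractibleSpace_arch (F := F) c.pos
  c.boxDiffCorePHomeomorph.contractibleSpace

/-- The box minus the core is path connected. [folklore] -/
lemma pathConnectedSpace_boxDiffCore [Nontrivial F] : PathConnectedSpace ↥(c.box ∩ c.coreᶜ) := by
  have h1 := HalfBall.isPathConnected_halfBox_diff_ball (F := F) c.pos
  rw [isPathConnected_iff_pathConnectedSpace] at h1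
  haveI := h1
  exact c.boxDiffCoreHomeomorph.symm.surjective.pathConnectedSpace c.boxDiffCoreHomeomorph.symm.continuous

/-! ### The homological transfer -/

section Transfer

/-- The point `p` in the space `↥(box) ∖ core`. [folklore] -/
def pBoxS : ↥((Subtype.val ⁻¹' c.core)ᶜ : Set ↥c.box) :=
  ⟨⟨p, c.p_mem_box⟩, fun hp => c.p_not_mem_core hp⟩

/-- The point `p` in the space `X ∖ core`. [folklore] -/
def pS : ↥(c.coreᶜ : Set X) := ⟨p, c.p_not_mem_core⟩

/-- `↥(box) ∖ core ≃ₜ ↥(box ∩ coreᶜ)` (re-association of subtypes). [folklore] -/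
def boxSHomeomorph : ↥((Subtype.val ⁻¹' c.core)ᶜ : Set ↥c.box) ≃ₜ ↥(c.box ∩ c.coreᶜ) where
  toFun x := ⟨x.1.1, x.1.2, x.2⟩
  invFun y := ⟨⟨y.1, y.2.1⟩, y.2.2⟩
  left_inv _ := rfl
  right_inv _ := rfl
  continuous_toFun := (continuous_subtype_val.comp continuous_subtype_val).subtype_mk _
  continuous_invFun := (continuous_subtype_val.subtype_mk _).subtype_mk _

/-- `(↥(box) ∖ core) ∖ p ≃ₜ ↥(box ∩ coreᶜ ∩ {p}ᶜ)` (re-association of subtypes). [folklore] -/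
def boxSPHomeomorph :
    ↥(({c.pBoxS}ᶜ : Set ↥((Subtype.val ⁻¹' c.core)ᶜ : Set ↥c.box))) ≃ₜ ↥(c.box ∩ c.coreᶜ ∩ {p}ᶜ) where
  toFun x := ⟨x.1.1.1, ⟨x.1.1.2, x.1.2⟩, fun hx => x.2 (Subtype.ext (Subtype.ext hx))⟩
  invFun y := ⟨⟨⟨y.1, y.2.1.1⟩, y.2.1.2⟩, fun hy =>
    y.2.2 (congrArg (fun z : ↥((Subtype.val ⁻¹' c.core)ᶜ : Set ↥c.box) => (z.1.1 : X)) hy)⟩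
  left_inv _ := rfl
  right_inv _ := rfl
  continuous_toFun :=
    ((continuous_subtype_val.comp continuous_subtype_val).comp continuous_subtype_val).subtype_mk _
  continuous_invFun := ((continuous_subtype_val.subtype_mk _).subtype_mk _).subtype_mk _

/-- `↥box ∖ core` is path connected. [folklore] -/
instance pathConnectedSpace_boxS [Nontrivial F] : PathConnectedSpace ↥((Subtype.val ⁻¹' c.core)ᶜ : Set ↥c.box) :=
  haveI := c.pathConnectedSpace_boxDiffCore
  c.boxSHomeomorph.symm.surjective.pathConnectedSpace c.boxSHomeomorph.symm.continuous

/-- `(↥box ∖ core) ∖ p` is contractible. [folklore] -/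
instance contractibleSpace_boxSP :
    ContractibleSpace ↥(({c.pBoxS}ᶜ : Set ↥((Subtype.val ⁻¹' c.core)ᶜ : Set ↥c.box))) :=
  haveI := c.contractibleSpace_boxDiffCoreP
  c.boxSPHomeomorph.contractibleSpace

/-- **Restriction from the core to its centre is an isomorphism** `H(X | N⁺) ≅ H(X | y)` (radial
push-out in the half chart; the closed sup-ball `[0, 2h] × closedBall 0 h` lies in the closed
half-space). [folklore] -/
theorem isIso_restrictToPoint_center [T2Space X] [ProperSpace F] (k : ℕ) :
    IsIso (restrictToPoint R M c.center_mem_core k) := by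
  have hK : c.core = c.e.source ∩ c.e ⁻¹' ball (c.e c.center) h := by rw [c.apply_center]; rfl
  have hρt : closedBall (c.e c.center) h ⊆ c.e.target := by
    rw [c.apply_center]; exact c.closedBall_center_subset_target
  exact isIso_restrictToPoint_of_starConvex_partialEquiv R M c.e c.isOpen_source c.continuousOn
    c.continuousOn_symm c.center_mem_source c.pos hρt ((convex_ball _ _).starConvex (mem_ball_self c.pos))
    (mem_ball_self c.pos) subset_rfl hK c.center_mem_core k

/-- The excision isomorphism `H(box | core) ≅ H(X | core)`. [folklore] -/
def boxExcision [T2Space X] [ProperSpace F] (k : ℕ) :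
    localHomologyOfSet R M (↥c.box) (Subtype.val ⁻¹' c.core) k ≅ localHomologyOfSet R M X c.core k :=
  localHomologyOfSet.openSubsetIso R M c.isOpen_box c.closure_core_subset_box k

/-- The map `Φ = (restriction to p) ∘ ∂ : Hₙ₊₁(X | N⁺) → Hₙ(X ∖ N⁺) → Hₙ(X ∖ N⁺ | p)`. [folklore] -/
def Φ (n : ℕ) : localHomologyOfSet R M X c.core (n + 1) ⟶ localHomology R M ↥(c.coreᶜ : Set X) c.pS n :=
  relativeSingularHomology.δ R M X c.coreᶜ n ≫ singularHomology.toLocal R M c.pS n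

/-- The inclusion `↥(box) ∖ core → X ∖ core`. [folklore] -/
abbrev ιS : C(↥((Subtype.val ⁻¹' c.core)ᶜ : Set ↥c.box), ↥(c.coreᶜ : Set X)) :=
  subsetRestrict (subsetIncl c.box) (localHomologyOfSet.mapsTo_subsetIncl_compl c.box c.core)

/-- `ιS` is injective. [folklore] -/
lemma ιS_injective : Function.Injective c.ιS := fun x y hxy => by
  have hval : (x.1.1 : X) = y.1.1 := congrArg (fun z : ↥(c.coreᶜ : Set X) => (z : X)) hxy
  exact Subtype.ext (Subtype.ext hval)

/-- `ιS` is a map of pairs away from `p`. [folklore] -/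
lemma mapsTo_ιS : MapsTo c.ιS ({c.pBoxS}ᶜ : Set _) ({c.pS}ᶜ : Set _) := fun _ hx h =>
  hx (c.ιS_injective (h.trans rfl))

/-- The open subset `box ∖ core` of `X ∖ core`, as a subset of the subtype. [folklore] -/
def boxInS : Set ↥(c.coreᶜ : Set X) := Subtype.val ⁻¹' c.box

/-- `box ∖ core` is open in `X ∖ core`. [folklore] -/
lemma isOpen_boxInS : IsOpen c.boxInS := c.isOpen_box.preimage continuous_subtype_val

/-- `p` lies in `box ∖ core`. [folklore] -/
lemma pS_mem_boxInS : c.pS ∈ c.boxInS := c.p_mem_box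

/-- `↥(box) ∖ core ≃ₜ ↥(boxInS)` compatibly with the inclusions into `X ∖ core`. [folklore] -/
def boxSHomeomorph' : ↥((Subtype.val ⁻¹' c.core)ᶜ : Set ↥c.box) ≃ₜ ↥c.boxInS where
  toFun x := ⟨⟨x.1.1, x.2⟩, x.1.2⟩
  invFun y := ⟨⟨y.1.1, y.2⟩, y.1.2⟩
  left_inv _ := rfl
  right_inv _ := rfl
  continuous_toFun := ((continuous_subtype_val.comp continuous_subtype_val).subtype_mk _).subtype_mk _
  continuous_invFun := ((continuous_subtype_val.comp continuous_subtype_val).subtype_mk _).subtype_mk _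

/-- `boxSHomeomorph'` as a continuous map. [folklore] -/
abbrev θ : C(↥((Subtype.val ⁻¹' c.core)ᶜ : Set ↥c.box), ↥c.boxInS) := c.boxSHomeomorph'

/-- The inverse of `boxSHomeomorph'` as a continuous map. [folklore] -/
abbrev θinv : C(↥c.boxInS, ↥((Subtype.val ⁻¹' c.core)ᶜ : Set ↥c.box)) := c.boxSHomeomorph'.symm

/-- `ιS` factors through `θ` and the inclusion of `box ∖ core`. [folklore] -/
lemma subsetIncl_comp_θ : (subsetIncl c.boxInS).comp c.θ = c.ιS := rfl

/-- `θ` is a map of pairs away from `p`. [folklore] -/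
lemma mapsTo_θ : MapsTo c.θ ({c.pBoxS}ᶜ : Set _) ({c.θ c.pBoxS}ᶜ : Set _) :=
  fun _ hx h => hx (c.boxSHomeomorph'.injective h)

/-- `θ⁻¹` is a map of pairs away from `p`. [folklore] -/
lemma mapsTo_θinv : MapsTo c.θinv ({c.θ c.pBoxS}ᶜ : Set _) ({c.pBoxS}ᶜ : Set _) := fun y hy h => hy (by
  rw [mem_singleton_iff] at h ⊢
  rw [← h]
  exact (c.boxSHomeomorph'.apply_symm_apply y).symm)

/-- The inclusion of `box ∖ core` is a map of pairs away from `p`. [folklore] -/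
lemma mapsTo_subsetIncl_boxInS :
    MapsTo (subsetIncl c.boxInS) ({c.θ c.pBoxS}ᶜ : Set _) ({c.pS}ᶜ : Set _) :=
  fun _ hy h => hy (Subtype.ext h)

/-- The local map `Hₙ(↥box ∖ core | p) → Hₙ(X ∖ core | p)` induced by `ιS` is an isomorphism
(open embedding: a homeomorphism onto an open subset, then excision). [folklore] -/
theorem isIso_map_ιS [T2Space X] (k : ℕ) :
    IsIso (relativeSingularHomology.map R M c.ιS c.mapsTo_ιS k) := by
  haveI h1 : IsIso (relativeSingularHomology.map R M c.θ c.mapsTo_θ k) := by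
    refine ⟨⟨relativeSingularHomology.map R M c.θinv c.mapsTo_θinv k, ?_, ?_⟩⟩
    · rw [← relativeSingularHomology.map_comp, ← relativeSingularHomology.map_id]
      congr 1
    · rw [← relativeSingularHomology.map_comp, ← relativeSingularHomology.map_id]
      congr 1
  haveI h2 : IsIso (relativeSingularHomology.map R M (subsetIncl c.boxInS)
      c.mapsTo_subsetIncl_boxInS k) :=
    localHomology.isIso_map_subsetIncl_of_isOpen R M c.isOpen_boxInS (c.boxSHomeomorph' c.pBoxS).2 k
  have hcomp := relativeSingularHomology.map_comp R M c.θ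
    (subsetIncl c.boxInS) c.mapsTo_θ c.mapsTo_subsetIncl_boxInS k
  change IsIso (relativeSingularHomology.map R M ((subsetIncl c.boxInS).comp c.θ)
    (c.mapsTo_subsetIncl_boxInS.comp c.mapsTo_θ) k)
  rw [hcomp]
  infer_instance

/-- **`Φ` is an isomorphism**: after excision to the box, `∂` is an isomorphism (the box is
contractible, `n ≥ 1`) and so is `Hₙ(box ∖ N⁺) → Hₙ(box ∖ N⁺ | p)` (`box ∖ N⁺ ∖ p ≅` the
punctured arch is contractible, `box ∖ N⁺` is path connected). [folklore] -/
theorem isIso_Φ [T2Space X] [ProperSpace F] [Nontrivial F] {n : ℕ} (hn : n ≠ 0) :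
    IsIso (c.Φ R M n) := by
  -- the box-level composite
  haveI hδ := isIso_δ_of_contractibleSpace R M (X := ↥c.box) ((Subtype.val ⁻¹' c.core)ᶜ) hn
  haveI hτ := isIso_toLocal_of_contractibleSpace_compl R M c.pBoxS hn
  haveI hι := c.isIso_map_ιS R M n
  haveI hexc : IsIso (c.boxExcision R M (n + 1)).hom := inferInstance
  have key : (c.boxExcision R M (n + 1)).hom ≫ c.Φ R M n =
      relativeSingularHomology.δ R M (↥c.box) (Subtype.val ⁻¹' c.core)ᶜ n ≫
        singularHomology.toLocal R M c.pBoxS n ≫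
          relativeSingularHomology.map R M c.ιS c.mapsTo_ιS n := by
    change relativeSingularHomology.map R M (subsetIncl c.box) _ (n + 1) ≫
      relativeSingularHomology.δ R M X c.coreᶜ n ≫ singularHomology.toLocal R M c.pS n = _
    rw [← relativeSingularHomology.δ_naturality_assoc]
    congr 1
    exact (relativeSingularHomology.ofAbsolute_comp_map R M c.ιS c.mapsTo_ιS n).symm
  haveI : IsIso ((c.boxExcision R M (n + 1)).hom ≫ c.Φ R M n) := by
    rw [key]
    infer_instance
  exact IsIso.of_isIso_comp_left (c.boxExcision R M (n + 1)).hom _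

end Transfer

/-! ### From the boundary to the interior -/

section Conclusion

/-- `B` as a subset of `X ∖ N⁺`: the identity of `X` is a map of pairs `(X, B) → (X, X ∖ N⁺)`. [folklore] -/
lemma mapsTo_id_B_compl_core : MapsTo (ContinuousMap.id X) B (c.coreᶜ : Set X) :=
  fun _ hx => c.B_subset_compl_core hx

/-- The inclusion `↥B → X ∖ N⁺`. [folklore] -/
abbrev jB : C(↥B, ↥(c.coreᶜ : Set X)) := subsetRestrict (ContinuousMap.id X) c.mapsTo_id_B_compl_core

/-- `jB` is a map of pairs away from `p`. [folklore] -/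
lemma mapsTo_jB (hpB : p ∈ B) : MapsTo c.jB ({(⟨p, hpB⟩ : ↥B)}ᶜ : Set _) ({c.pS}ᶜ : Set _) :=
  fun _ hx h => hx (Subtype.ext (congrArg (fun z : ↥(c.coreᶜ : Set X) => (z : X)) h))

/-- The class `z₁ ∈ Hₙ₊₁(X | N⁺)` of a relative class `z ∈ Hₙ₊₁(X, B)`. [folklore] -/
def coreClass (n : ℕ) (z : relativeSingularHomology R M X B (n + 1)) :
    localHomologyOfSet R M X c.core (n + 1) :=
  relativeSingularHomology.map R M (ContinuousMap.id X) c.mapsTo_id_B_compl_core (n + 1) z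

/-- **`Φ(z₁)` is the image of `(∂z)|ₚ` under the local inclusion `Hₙ(B | p) → Hₙ(X ∖ N⁺ | p)`**
(naturality of `∂` for `(X, B) → (X, X ∖ N⁺)` and of the passage to local homology). [folklore] -/
theorem Φ_coreClass (hpB : p ∈ B) (n : ℕ) (z : relativeSingularHomology R M X B (n + 1)) :
    c.Φ R M n (c.coreClass R M n z) =
      relativeSingularHomology.map R M c.jB (c.mapsTo_jB hpB) n
        (singularHomology.toLocal R M ((⟨p, hpB⟩ : ↥B)) n (relativeSingularHomology.δ R M X B n z)) := by
  have key : relativeSingularHomology.map R M (ContinuousMap.id X) c.mapsTo_id_B_compl_core (n + 1) ≫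
      c.Φ R M n = relativeSingularHomology.δ R M X B n ≫ singularHomology.toLocal R M ((⟨p, hpB⟩ : ↥B)) n ≫
        relativeSingularHomology.map R M c.jB (c.mapsTo_jB hpB) n := by
    change _ ≫ relativeSingularHomology.δ R M X c.coreᶜ n ≫ singularHomology.toLocal R M c.pS n = _
    rw [← relativeSingularHomology.δ_naturality_assoc]
    congr 1
    exact (relativeSingularHomology.ofAbsolute_comp_map R M c.jB (c.mapsTo_jB hpB) n).symm
  exact congrFun (congrArg (fun f => (ConcreteCategory.hom f : _ → _)) key) z

/-! #### The local inclusion `Hₙ(B | p) → Hₙ(X ∖ N⁺ | p)` is an isomorphism -/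

/-- The neighbourhood `V ∩ B` of `p` in `↥B`. [folklore] -/
def nearB : Set ↥B := Subtype.val ⁻¹' c.near

/-- The neighbourhood `V ∖ N⁺ = V ∩ B` of `p` in `X ∖ N⁺`. [folklore] -/
def nearS : Set ↥(c.coreᶜ : Set X) := Subtype.val ⁻¹' c.near

/-- `V ∩ B` is open in `↥B`. [folklore] -/
lemma isOpen_nearB : IsOpen c.nearB := c.isOpen_near.preimage continuous_subtype_val

/-- `V ∖ N⁺` is open in `X ∖ N⁺`. [folklore] -/
lemma isOpen_nearS : IsOpen c.nearS := c.isOpen_near.preimage continuous_subtype_val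

/-- `p ∈ V ∩ B`. [folklore] -/
lemma pB_mem_nearB (hpB : p ∈ B) : (⟨p, hpB⟩ : ↥B) ∈ c.nearB := c.p_mem_near

/-- `p ∈ V ∖ N⁺`. [folklore] -/
lemma pS_mem_nearS : c.pS ∈ c.nearS := c.p_mem_near

/-- `V ∩ B ≃ₜ V ∖ N⁺` (the same subset of `X`, by local coincidence). [folklore] -/
def nearHomeomorph : ↥c.nearB ≃ₜ ↥c.nearS where
  toFun x := ⟨⟨x.1.1, (c.mem_near_diff_core_iff x.2).2 x.1.2⟩, x.2⟩
  invFun y := ⟨⟨y.1.1, (c.mem_near_diff_core_iff y.2).1 y.1.2⟩, y.2⟩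
  left_inv _ := rfl
  right_inv _ := rfl
  continuous_toFun := ((continuous_subtype_val.comp continuous_subtype_val).subtype_mk _).subtype_mk _
  continuous_invFun := ((continuous_subtype_val.comp continuous_subtype_val).subtype_mk _).subtype_mk _

/-- `nearHomeomorph` as a continuous map. [folklore] -/
abbrev θB : C(↥c.nearB, ↥c.nearS) := c.nearHomeomorph

/-- Its inverse. [folklore] -/
abbrev θBinv : C(↥c.nearS, ↥c.nearB) := c.nearHomeomorph.symm

/-- `θB` is a map of pairs away from `p`. [folklore] -/
lemma mapsTo_θB (hpB : p ∈ B) :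
    MapsTo c.θB ({⟨(⟨p, hpB⟩ : ↥B), c.pB_mem_nearB hpB⟩}ᶜ : Set _) ({c.θB ⟨(⟨p, hpB⟩ : ↥B), c.pB_mem_nearB hpB⟩}ᶜ : Set _) :=
  fun _ hx h => hx (c.nearHomeomorph.injective h)

/-- `θB⁻¹` is a map of pairs away from `p`. [folklore] -/
lemma mapsTo_θBinv (hpB : p ∈ B) :
    MapsTo c.θBinv ({c.θB ⟨(⟨p, hpB⟩ : ↥B), c.pB_mem_nearB hpB⟩}ᶜ : Set _)
      ({⟨(⟨p, hpB⟩ : ↥B), c.pB_mem_nearB hpB⟩}ᶜ : Set _) := fun y hy h => hy (by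
  rw [mem_singleton_iff] at h ⊢
  rw [← h]
  exact (c.nearHomeomorph.apply_symm_apply y).symm)

/-- The inclusion of `V ∖ N⁺` is a map of pairs away from `p`. [folklore] -/
lemma mapsTo_subsetIncl_nearS (hpB : p ∈ B) :
    MapsTo (subsetIncl c.nearS) ({c.θB ⟨(⟨p, hpB⟩ : ↥B), c.pB_mem_nearB hpB⟩}ᶜ : Set _) ({c.pS}ᶜ : Set _) :=
  fun _ hy h => hy (Subtype.ext h)

/-- **Local coincidence**: `Hₙ(B | p) → Hₙ(X ∖ N⁺ | p)` is an isomorphism, since near `p` the two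
spaces coincide (`V ∩ B = V ∖ N⁺`) and local homology depends only on a neighbourhood. [folklore] -/
theorem isIso_map_jB [T2Space X] (hpB : p ∈ B) (k : ℕ) :
    IsIso (relativeSingularHomology.map R M c.jB (c.mapsTo_jB hpB) k) := by
  haveI hB := localHomology.isIso_map_subsetIncl_of_isOpen R M c.isOpen_nearB (c.pB_mem_nearB hpB) k
  haveI hθ : IsIso (relativeSingularHomology.map R M c.θB (c.mapsTo_θB hpB) k) := by
    refine ⟨⟨relativeSingularHomology.map R M c.θBinv (c.mapsTo_θBinv hpB) k, ?_, ?_⟩⟩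
    · rw [← relativeSingularHomology.map_comp, ← relativeSingularHomology.map_id]
      congr 1
    · rw [← relativeSingularHomology.map_comp, ← relativeSingularHomology.map_id]
      congr 1
  haveI hS : IsIso (relativeSingularHomology.map R M (subsetIncl c.nearS)
      (c.mapsTo_subsetIncl_nearS hpB) k) :=
    localHomology.isIso_map_subsetIncl_of_isOpen R M c.isOpen_nearS (c.θB ⟨(⟨p, hpB⟩ : ↥B), c.pB_mem_nearB hpB⟩).2 k
  have heq : relativeSingularHomology.map R M (subsetIncl c.nearB)
      (localHomology.mapsTo_subsetIncl_compl (c.pB_mem_nearB hpB)) k ≫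
        relativeSingularHomology.map R M c.jB (c.mapsTo_jB hpB) k =
      relativeSingularHomology.map R M c.θB (c.mapsTo_θB hpB) k ≫
        relativeSingularHomology.map R M (subsetIncl c.nearS) (c.mapsTo_subsetIncl_nearS hpB) k := by
    rw [← relativeSingularHomology.map_comp, ← relativeSingularHomology.map_comp]
    rfl
  haveI : IsIso (relativeSingularHomology.map R M (subsetIncl c.nearB)
      (localHomology.mapsTo_subsetIncl_compl (c.pB_mem_nearB hpB)) k ≫
        relativeSingularHomology.map R M c.jB (c.mapsTo_jB hpB) k) := by
    rw [heq]
    infer_instance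
  exact IsIso.of_isIso_comp_left (relativeSingularHomology.map R M (subsetIncl c.nearB)
      (localHomology.mapsTo_subsetIncl_compl (c.pB_mem_nearB hpB)) k) _

/-! #### Generators -/

/-- If `(∂z)|ₚ` generates `Hₙ(B | p; R)` then `z₁` generates `Hₙ₊₁(X | N⁺; R)`. [folklore] -/
theorem isGenerator_coreClass [T2Space X] [ProperSpace F] [Nontrivial F] (hpB : p ∈ B) {n : ℕ} (hn : n ≠ 0)
    (z : relativeSingularHomology R R X B (n + 1))
    (hg : ∃ e : localHomology R R ↥B ((⟨p, hpB⟩ : ↥B)) n ≃ₗ[R] R,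
      e (singularHomology.toLocal R R ((⟨p, hpB⟩ : ↥B)) n (relativeSingularHomology.δ R R X B n z)) = 1) :
    ∃ e : localHomologyOfSet R R X c.core (n + 1) ≃ₗ[R] R, e (c.coreClass R R n z) = 1 := by
  haveI := c.isIso_Φ R R hn
  haveI := c.isIso_map_jB R R hpB n
  have h1 : ∃ e : localHomology R R ↥(c.coreᶜ : Set X) c.pS n ≃ₗ[R] R,
      e (c.Φ R R n (c.coreClass R R n z)) = 1 := by
    rw [c.Φ_coreClass R R hpB]
    exact (isGenerator_iff_of_isIso R _ _).2 hg
  exact (isGenerator_iff_of_isIso R (c.Φ R R n) _).1 h1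

/-- The centre of the core is not a point of `B`. [folklore] -/
lemma center_not_mem_B : c.center ∈ (Bᶜ : Set X) := fun hB =>
  c.B_subset_compl_core hB c.center_mem_core

/-- Restricting `z₁` to a point of the core gives the local image of `z` there. [folklore] -/
lemma restrictToPoint_coreClass (n : ℕ) (z : relativeSingularHomology R M X B (n + 1)) {x : X}
    (hx : x ∈ c.core) :
    restrictToPoint R M hx (n + 1) (c.coreClass R M n z) =
      relativeSingularHomology.toLocal R M B ⟨x, fun hB => c.B_subset_compl_core hB hx⟩ (n + 1) z := by
  change (relativeSingularHomology.map R M (ContinuousMap.id X) _ (n + 1) ≫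
    relativeSingularHomology.map R M (ContinuousMap.id X) _ (n + 1)) z = _
  rw [← relativeSingularHomology.map_comp]
  rfl

/-- **Transfer to the centre of the core**: if `(∂z)|ₚ` generates `Hₙ(B | p; R)` then `z|_y`
generates `Hₙ₊₁(X | y; R)` for the interior point `y = e⁻¹(h, 0)`. [folklore] -/
theorem isGenerator_toLocal_center [T2Space X] [ProperSpace F] [Nontrivial F] (hpB : p ∈ B) {n : ℕ} (hn : n ≠ 0)
    (z : relativeSingularHomology R R X B (n + 1))
    (hg : ∃ e : localHomology R R ↥B ((⟨p, hpB⟩ : ↥B)) n ≃ₗ[R] R,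
      e (singularHomology.toLocal R R ((⟨p, hpB⟩ : ↥B)) n (relativeSingularHomology.δ R R X B n z)) = 1) :
    ∃ e : localHomology R R X c.center (n + 1) ≃ₗ[R] R,
      e (relativeSingularHomology.toLocal R R B ⟨c.center, c.center_not_mem_B⟩ (n + 1) z) = 1 := by
  haveI := c.isIso_restrictToPoint_center R R (n + 1)
  rw [← c.restrictToPoint_coreClass R R n z c.center_mem_core]
  exact (isGenerator_iff_of_isIso R (restrictToPoint R R c.center_mem_core (n + 1)) _).2
    (c.isGenerator_coreClass R hpB hn z hg)

/-! #### Local constancy on the core, and the conclusion at every point of the core -/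

/-- Every point of the core has an open neighbourhood `T ⊆ N⁺` such that restriction
`H(X | T) → H(X | x')` is an isomorphism for every `x' ∈ T` (a small convex chart ball). [folklore] -/
theorem exists_isOpen_forall_isIso_restrictToPoint_of_mem_core [T2Space X] [ProperSpace F] {x : X} (hx : x ∈ c.core) :
    ∃ T : Set X, IsOpen T ∧ x ∈ T ∧ T ⊆ c.core ∧
      ∀ (x' : X) (hx' : x' ∈ T) (k : ℕ), IsIso (restrictToPoint R M hx' k) := by
  obtain ⟨hxs, hxb⟩ := hx
  set v : ℝ × F := c.e x with hv
  set d : ℝ := dist v ((h, 0) : ℝ × F) with hd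
  have hdh : d < h := hxb
  set ρ : ℝ := (h - d) / 4 with hρ
  have hρ0 : 0 < ρ := by rw [hρ]; linarith
  set T : Set X := c.e.source ∩ c.e ⁻¹' ball v ρ with hT
  have hball : ball v (3 * ρ + ρ / 2) ⊆ ball ((h, 0) : ℝ × F) h := by
    intro w hw
    rw [mem_ball] at hw ⊢
    calc dist w (h, 0) ≤ dist w v + dist v (h, 0) := dist_triangle _ _ _
      _ < (3 * ρ + ρ / 2) + d := by linarith
      _ ≤ h := by rw [hρ]; linarith
  refine ⟨T, c.continuousOn.isOpen_inter_preimage c.isOpen_source isOpen_ball, ⟨hxs, mem_ball_self hρ0⟩,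
    fun y hy => ⟨hy.1, hball (ball_subset_ball (by linarith) hy.2)⟩, fun x' hx' k => ?_⟩
  have hx'v : dist (c.e x') v < ρ := hx'.2
  have hρt : closedBall (c.e x') (2 * ρ) ⊆ c.e.target := by
    refine Subset.trans ?_ (ball_subset_closedBall.trans c.closedBall_center_subset_target)
    refine Subset.trans (fun w hw => ?_) hball
    rw [mem_closedBall] at hw
    rw [mem_ball]
    calc dist w v ≤ dist w (c.e x') + dist (c.e x') v := dist_triangle _ _ _
      _ < 2 * ρ + ρ + ρ / 2 := by linarith
      _ = 3 * ρ + ρ / 2 := by ring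
  have hCρ : ball v ρ ⊆ ball (c.e x') (2 * ρ) := fun w hw => by
    rw [mem_ball] at hw ⊢
    calc dist w (c.e x') ≤ dist w v + dist v (c.e x') := dist_triangle _ _ _
      _ < ρ + ρ := by rw [dist_comm v]; linarith
      _ = 2 * ρ := by ring
  exact isIso_restrictToPoint_of_starConvex_partialEquiv R M c.e c.isOpen_source c.continuousOn
    c.continuousOn_symm hx'.1 (by linarith) hρt ((convex_ball v ρ).starConvex hx'.2) hx'.2 hCρ rfl hx' k

/-- The core is preconnected (the image of a ball under the inverse chart). [folklore] -/
theorem isPreconnected_core : IsPreconnected c.core := by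
  have heq : c.core = c.e.symm '' ball ((h, 0) : ℝ × F) h :=
    (c.e.symm_image_eq_source_inter_preimage
      (ball_subset_closedBall.trans c.closedBall_center_subset_target)).symm
  rw [heq]
  exact (convex_ball _ _).isPreconnected.image _
    (c.continuousOn_symm.mono (ball_subset_closedBall.trans c.closedBall_center_subset_target))

/-- **Transfer to every point of the core**: if `(∂z)|ₚ` generates `Hₙ(B | p; R)` then `z|ₓ`
generates `Hₙ₊₁(X | x; R)` for every `x ∈ N⁺` (clopen argument on the preconnected core: the set
of good points is open and closed in `N⁺` by local constancy, and contains the centre). [folklore] -/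
theorem isGenerator_toLocal_of_mem_core [T2Space X] [ProperSpace F] [Nontrivial F] (hpB : p ∈ B) {n : ℕ} (hn : n ≠ 0)
    (z : relativeSingularHomology R R X B (n + 1))
    (hg : ∃ e : localHomology R R ↥B ((⟨p, hpB⟩ : ↥B)) n ≃ₗ[R] R,
      e (singularHomology.toLocal R R ((⟨p, hpB⟩ : ↥B)) n (relativeSingularHomology.δ R R X B n z)) = 1)
    {x : X} (hx : x ∈ c.core) :
    ∃ e : localHomology R R X x (n + 1) ≃ₗ[R] R,
      e (relativeSingularHomology.toLocal R R B ⟨x, fun hB => c.B_subset_compl_core hB hx⟩ (n + 1) z) = 1 := by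
  -- the predicate "`z` is a local generator at `x`"
  let gen : X → Prop := fun x => ∃ hx : x ∈ (Bᶜ : Set X),
    ∃ e : localHomology R R X x (n + 1) ≃ₗ[R] R, e (relativeSingularHomology.toLocal R R B ⟨x, hx⟩ (n + 1) z) = 1
  -- local constancy of `gen` on the core
  have hloc : ∀ x ∈ c.core, ∃ T : Set X, IsOpen T ∧ x ∈ T ∧ T ⊆ c.core ∧ ∀ x' ∈ T, (gen x' ↔ gen x) := by
    intro x hx
    obtain ⟨T, hTo, hxT, hTc, hiso⟩ := c.exists_isOpen_forall_isIso_restrictToPoint_of_mem_core R R hx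
    have hBT : MapsTo (ContinuousMap.id X) B (Tᶜ : Set X) := fun y hy hyT =>
      c.B_subset_compl_core hy (hTc hyT)
    let zT : localHomologyOfSet R R X T (n + 1) :=
      relativeSingularHomology.map R R (ContinuousMap.id X) hBT (n + 1) z
    have hres : ∀ (x' : X) (hx' : x' ∈ T), restrictToPoint R R hx' (n + 1) zT =
        relativeSingularHomology.toLocal R R B ⟨x', fun hB => c.B_subset_compl_core hB (hTc hx')⟩ (n + 1) z := by
      intro x' hx'
      change (relativeSingularHomology.map R R (ContinuousMap.id X) _ (n + 1) ≫
        relativeSingularHomology.map R R (ContinuousMap.id X) _ (n + 1)) z = _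
      rw [← relativeSingularHomology.map_comp]
      rfl
    have hgen : ∀ (x' : X) (hx' : x' ∈ T), gen x' ↔ ∃ e : localHomologyOfSet R R X T (n + 1) ≃ₗ[R] R, e zT = 1 := by
      intro x' hx'
      haveI := hiso x' hx' (n + 1)
      have hx'B : x' ∈ (Bᶜ : Set X) := fun hB => c.B_subset_compl_core hB (hTc hx')
      constructor
      · rintro ⟨_, hx'g⟩
        rw [← hres x' hx'] at hx'g
        exact (isGenerator_iff_of_isIso R (restrictToPoint R R hx' (n + 1)) zT).1 hx'g
      · intro hT
        refine ⟨hx'B, ?_⟩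
        rw [← hres x' hx']
        exact (isGenerator_iff_of_isIso R (restrictToPoint R R hx' (n + 1)) zT).2 hT
    exact ⟨T, hTo, hxT, hTc, fun x' hx' => (hgen x' hx').trans (hgen x hxT).symm⟩
  -- the clopen argument
  let U : Set X := {x | ∃ T : Set X, IsOpen T ∧ x ∈ T ∧ T ⊆ c.core ∧ ∀ x' ∈ T, gen x'}
  let V : Set X := {x | ∃ T : Set X, IsOpen T ∧ x ∈ T ∧ T ⊆ c.core ∧ ∀ x' ∈ T, ¬ gen x'}
  have hUo : IsOpen U := isOpen_iff_forall_mem_open.2 fun x ⟨T, hTo, hxT, hTc, hT⟩ =>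
    ⟨T, fun y hy => ⟨T, hTo, hy, hTc, hT⟩, hTo, hxT⟩
  have hVo : IsOpen V := isOpen_iff_forall_mem_open.2 fun x ⟨T, hTo, hxT, hTc, hT⟩ =>
    ⟨T, fun y hy => ⟨T, hTo, hy, hTc, hT⟩, hTo, hxT⟩
  have hcover : c.core ⊆ U ∪ V := by
    intro x hx
    obtain ⟨T, hTo, hxT, hTc, hT⟩ := hloc x hx
    by_cases hgx : gen x
    · exact Or.inl ⟨T, hTo, hxT, hTc, fun x' hx' => (hT x' hx').2 hgx⟩
    · exact Or.inr ⟨T, hTo, hxT, hTc, fun x' hx' h' => hgx ((hT x' hx').1 h')⟩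
  have hcenter : gen c.center := ⟨c.center_not_mem_B, c.isGenerator_toLocal_center R hpB hn z hg⟩
  have hUne : (c.core ∩ U).Nonempty := by
    obtain ⟨T, hTo, hxT, hTc, hT⟩ := hloc c.center c.center_mem_core
    exact ⟨c.center, c.center_mem_core, T, hTo, hxT, hTc, fun x' hx' => (hT x' hx').2 hcenter⟩
  by_contra hng
  have hxB : x ∈ (Bᶜ : Set X) := fun hB => c.B_subset_compl_core hB hx
  have hngen : ¬ gen x := fun ⟨_, h'⟩ => hng h'
  have hVne : (c.core ∩ V).Nonempty := by
    obtain ⟨T, hTo, hxT, hTc, hT⟩ := hloc x hx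
    exact ⟨x, hx, T, hTo, hxT, hTc, fun x' hx' h' => hngen ((hT x' hx').1 h')⟩
  obtain ⟨y, -, ⟨T, -, hyT, -, hT⟩, ⟨T', -, hyT', -, hT'⟩⟩ :=
    c.isPreconnected_core U V hUo hVo hcover hUne hVne
  exact hT' y hyT' (hT y hyT)

end Conclusion

end HalfChart

end Literature.AlgebraicTopology.SingularHomology


/-! ## Part VI — `C¹` manifolds with boundary: half charts from the atlas, good balls at interior
points, and the relative fundamental class from the boundary class -/



open CategoryTheory Limits Topology Metric Set
open scoped Manifold ContDiff


namespace Literature.AlgebraicTopology.SingularHomology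

variable (R : Type v) [CommRing R] (M : Type v) [AddCommGroup M] [Module R M]

namespace SmoothHalfChart

variable (n : ℕ) {X : Type u} [TopologicalSpace X] [ChartedSpace (EuclideanHalfSpace (n + 1)) X]

/-- Translation of the second component: `(a, w) ↦ (a, w - w₀)`, as a partial equivalence of
`ℝ × ℝⁿ` (source and target `univ`). [folklore] -/
def translate (w₀ : EuclideanSpace ℝ (Fin n)) :
    PartialEquiv (ℝ × EuclideanSpace ℝ (Fin n)) (ℝ × EuclideanSpace ℝ (Fin n)) where
  toFun v := (v.1, v.2 - w₀)
  invFun v := (v.1, v.2 + w₀)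
  source := univ
  target := univ
  map_source' _ _ := mem_univ _
  map_target' _ _ := mem_univ _
  left_inv' v _ := by simp
  right_inv' v _ := by simp

omit [TopologicalSpace X] [ChartedSpace (EuclideanHalfSpace (n + 1)) X] in
/-- The translation is continuous. [folklore] -/
lemma continuous_translate (w₀ : EuclideanSpace ℝ (Fin n)) : Continuous (translate n w₀) :=
  continuous_fst.prodMk (continuous_snd.sub continuous_const)

omit [TopologicalSpace X] [ChartedSpace (EuclideanHalfSpace (n + 1)) X] in
/-- The inverse translation is continuous. [folklore] -/
lemma continuous_translate_symm (w₀ : EuclideanSpace ℝ (Fin n)) : Continuous (translate n w₀).symm :=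
  continuous_fst.prodMk (continuous_snd.add continuous_const)

/-- The second model coordinate of the preferred chart at `x₀`, evaluated at `x₀`. [folklore] -/
def shift (x₀ : X) : EuclideanSpace ℝ (Fin n) :=
  (HalfSpaceModel.halfSpaceEquiv n (chartAt (EuclideanHalfSpace (n + 1)) x₀ x₀)).2

/-- The partial chart at `x₀` with values in `ℝ × ℝⁿ`: the preferred chart at `x₀`, followed by
the half-space model `EuclideanHalfSpace (n+1) ≃ {0 ≤ a}` and the translation moving the second
component of the image of `x₀` to `0`. [folklore] -/
def pe (x₀ : X) : PartialEquiv X (ℝ × EuclideanSpace ℝ (Fin n)) :=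
  (chartAt (EuclideanHalfSpace (n + 1)) x₀).toPartialEquiv.trans
    ((HalfSpaceModel.halfSpaceEquiv n).trans (translate n (shift n x₀)))

variable (x₀ : X)

/-- The source of `pe x₀` is the source of the preferred chart at `x₀`. [folklore] -/
lemma pe_source : (pe n x₀).source = (chartAt (EuclideanHalfSpace (n + 1)) x₀).source := by
  simp [pe, PartialEquiv.trans_source, HalfSpaceModel.halfSpaceEquiv_source, translate]

/-- `pe x₀`, unfolded. [folklore] -/
lemma pe_apply (x : X) : pe n x₀ x =
    ((HalfSpaceModel.halfSpaceEquiv n (chartAt (EuclideanHalfSpace (n + 1)) x₀ x)).1,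
      (HalfSpaceModel.halfSpaceEquiv n (chartAt (EuclideanHalfSpace (n + 1)) x₀ x)).2 - shift n x₀) := rfl

/-- The first component of `pe x₀ x` is the first model coordinate of the preferred chart. [folklore] -/
lemma pe_apply_fst (x : X) : (pe n x₀ x).1 = (chartAt (EuclideanHalfSpace (n + 1)) x₀ x).1 0 := by
  rw [pe_apply]
  exact HalfSpaceModel.halfSpaceEquiv_apply_fst n _

/-- `pe x₀ x₀ = (a₀, 0)`. [folklore] -/
lemma pe_apply_self : pe n x₀ x₀ = ((chartAt (EuclideanHalfSpace (n + 1)) x₀ x₀).1 0, 0) := by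
  refine Prod.ext (pe_apply_fst n x₀ x₀) ?_
  rw [pe_apply]
  exact sub_self _

/-- `x₀` lies in the source of `pe x₀`. [folklore] -/
lemma mem_pe_source : x₀ ∈ (pe n x₀).source := by
  rw [pe_source]; exact mem_chart_source _ x₀

/-- The source of `pe x₀` is open. [folklore] -/
lemma isOpen_pe_source : IsOpen (pe n x₀).source := by
  rw [pe_source]; exact (chartAt _ x₀).open_source

/-- `pe x₀` is continuous on its source. [folklore] -/
lemma continuousOn_pe : ContinuousOn (pe n x₀) (pe n x₀).source := by
  rw [pe_source]
  show ContinuousOn (fun x => translate n (shift n x₀)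
    (HalfSpaceModel.halfSpaceEquiv n (chartAt (EuclideanHalfSpace (n + 1)) x₀ x))) _
  exact ((continuous_translate n _).comp (HalfSpaceModel.continuous_halfSpaceEquiv n)).comp_continuousOn
    (chartAt (EuclideanHalfSpace (n + 1)) x₀).continuousOn

/-- The inverse of `pe x₀` as a globally defined continuous map into the model space. [folklore] -/
def peInvModel (v : ℝ × EuclideanSpace ℝ (Fin n)) : EuclideanHalfSpace (n + 1) :=
  (HalfSpaceModel.halfSpaceEquiv n).symm ((translate n (shift n x₀)).symm v)

/-- The model inverse is continuous. [folklore] -/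
lemma continuous_peInvModel : Continuous (peInvModel n x₀) :=
  (HalfSpaceModel.continuous_halfSpaceEquiv_symm n).comp (continuous_translate_symm n _)

/-- The inverse of `pe x₀` is the inverse chart after the model inverse. [folklore] -/
lemma pe_symm_apply (v : ℝ × EuclideanSpace ℝ (Fin n)) :
    (pe n x₀).symm v = (chartAt (EuclideanHalfSpace (n + 1)) x₀).symm (peInvModel n x₀ v) := rfl

/-- Membership in the target of `pe x₀`. [folklore] -/
lemma mem_pe_target_iff (v : ℝ × EuclideanSpace ℝ (Fin n)) :
    v ∈ (pe n x₀).target ↔ 0 ≤ v.1 ∧ peInvModel n x₀ v ∈ (chartAt (EuclideanHalfSpace (n + 1)) x₀).target := by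
  simp only [pe, PartialEquiv.trans_target, translate, HalfSpaceModel.halfSpaceEquiv_target, mem_inter_iff,
    mem_univ, mem_preimage, true_and, mem_setOf_eq, PartialEquiv.trans_symm_eq_symm_trans_symm,
    PartialEquiv.coe_trans, Function.comp_apply, peInvModel]
  exact Iff.rfl

/-- The target of `pe x₀` lies in the closed half-space. [folklore] -/
lemma pe_target_subset : (pe n x₀).target ⊆ {v | 0 ≤ v.1} := fun v hv =>
  ((mem_pe_target_iff n x₀ v).1 hv).1

/-- The inverse of `pe x₀` is continuous on the target. [folklore] -/
lemma continuousOn_pe_symm : ContinuousOn (pe n x₀).symm (pe n x₀).target := by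
  refine ContinuousOn.congr ?_ (fun v _ => pe_symm_apply n x₀ v)
  exact (chartAt (EuclideanHalfSpace (n + 1)) x₀).continuousOn_symm.comp
    (continuous_peInvModel n x₀).continuousOn (fun v hv => ((mem_pe_target_iff n x₀ v).1 hv).2)

/-- The model inverse sends `pe x₀ x₀` back to the chart image of `x₀`. [folklore] -/
lemma peInvModel_apply_self : peInvModel n x₀ (pe n x₀ x₀) = chartAt (EuclideanHalfSpace (n + 1)) x₀ x₀ := by
  have h1 : (translate n (shift n x₀)).symm (pe n x₀ x₀) =
      HalfSpaceModel.halfSpaceEquiv n (chartAt (EuclideanHalfSpace (n + 1)) x₀ x₀) :=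
    (translate n (shift n x₀)).left_inv (mem_univ _)
  rw [peInvModel, h1]
  exact (HalfSpaceModel.halfSpaceEquiv n).left_inv (mem_univ _)

/-- The target of `pe x₀` contains a half-ball around `pe x₀ x₀`. [folklore] -/
lemma exists_halfBall_subset_pe_target :
    ∃ ε > 0, {v : ℝ × EuclideanSpace ℝ (Fin n) | 0 ≤ v.1} ∩ ball (pe n x₀ x₀) ε ⊆ (pe n x₀).target := by
  have hO : IsOpen (peInvModel n x₀ ⁻¹' (chartAt (EuclideanHalfSpace (n + 1)) x₀).target) :=
    (continuous_peInvModel n x₀).isOpen_preimage _ (chartAt _ x₀).open_target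
  have hmem : pe n x₀ x₀ ∈ peInvModel n x₀ ⁻¹' (chartAt (EuclideanHalfSpace (n + 1)) x₀).target := by
    rw [mem_preimage, peInvModel_apply_self]
    exact mem_chart_target _ x₀
  obtain ⟨ε, hε, hball⟩ := Metric.isOpen_iff.1 hO _ hmem
  exact ⟨ε, hε, fun v hv => (mem_pe_target_iff n x₀ v).2 ⟨hv.1, hball hv.2⟩⟩

variable {m : WithTop ℕ∞} [IsManifold (𝓡∂ (n + 1)) m X]

/-- In the chart `pe x₀`, boundary points are those with vanishing first coordinate (`C¹` chart
independence of the boundary). [folklore] -/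
lemma mem_boundary_iff_pe_fst_eq_zero (hm : m ≠ 0) {x : X} (hx : x ∈ (pe n x₀).source) :
    x ∈ (𝓡∂ (n + 1)).boundary X ↔ (pe n x₀ x).1 = 0 := by
  rw [pe_apply_fst]
  rw [pe_source] at hx
  exact mem_boundary_iff_apply_zero_eq hm (chart_mem_atlas _ x₀) hx

/-- **Half charts exist at boundary points of a `C¹` manifold with boundary.** [folklore] -/
theorem exists_halfChart (hm : m ≠ 0) {p : X} (hp : p ∈ (𝓡∂ (n + 1)).boundary X) :
    ∃ h : ℝ, Nonempty (HalfChart ((𝓡∂ (n + 1)).boundary X) p (EuclideanSpace ℝ (Fin n)) h) := by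
  obtain ⟨ε, hε, hsub⟩ := exists_halfBall_subset_pe_target n p
  have hp0 : pe n p p = 0 := by
    have h1 : (pe n p p).1 = 0 := (mem_boundary_iff_pe_fst_eq_zero n p hm (mem_pe_source n p)).1 hp
    rw [pe_apply_self] at h1 ⊢
    exact Prod.ext h1 rfl
  refine ⟨ε / 8, ⟨{
    e := pe n p
    isOpen_source := isOpen_pe_source n p
    continuousOn := continuousOn_pe n p
    continuousOn_symm := continuousOn_pe_symm n p
    mem_source := mem_pe_source n p
    apply_eq_zero := hp0
    pos := by positivity
    target_subset := pe_target_subset n p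
    subset_target := fun v hv => hsub ⟨hv.1, ?_⟩
    mem_iff := fun x hx _ => mem_boundary_iff_pe_fst_eq_zero n p hm hx }⟩⟩
  rw [hp0, mem_ball]
  have := hv.2
  rw [mem_closedBall] at this
  linarith

/-- **Good balls at interior points**: every interior point has an open neighbourhood `T` of
interior points such that `H(X | T) → H(X | x')` is an isomorphism for every `x' ∈ T`. [folklore] -/
theorem exists_isOpen_forall_isIso_restrictToPoint_of_not_mem_boundary [T2Space X] (hm : m ≠ 0)
    {x : X} (hx : x ∉ (𝓡∂ (n + 1)).boundary X) :
    ∃ T : Set X, IsOpen T ∧ x ∈ T ∧ T ⊆ ((𝓡∂ (n + 1)).boundary X)ᶜ ∧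
      ∀ (x' : X) (hx' : x' ∈ T) (k : ℕ), IsIso (restrictToPoint R M hx' k) := by
  obtain ⟨ε, hε, hsub⟩ := exists_halfBall_subset_pe_target n x
  set a₀ : ℝ := (pe n x x).1 with ha₀
  have ha₀pos : 0 < a₀ := by
    have h0 : 0 ≤ a₀ := pe_target_subset n x (PartialEquiv.map_source _ (mem_pe_source n x))
    refine lt_of_le_of_ne h0 (Ne.symm fun h => hx ?_)
    exact (mem_boundary_iff_pe_fst_eq_zero n x hm (mem_pe_source n x)).2 h
  set ρ : ℝ := min a₀ ε / 4 with hρ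
  have hρ0 : 0 < ρ := by rw [hρ]; positivity
  have hρa : 4 * ρ ≤ a₀ := by rw [hρ]; linarith [min_le_left a₀ ε]
  have hρε : 4 * ρ ≤ ε := by rw [hρ]; linarith [min_le_right a₀ ε]
  have hfst : ∀ w : ℝ × EuclideanSpace ℝ (Fin n), |w.1 - (pe n x x).1| ≤ dist w (pe n x x) := fun w => by
    rw [Prod.dist_eq, Real.dist_eq]; exact le_max_left _ _
  have hballt : closedBall (pe n x x) (3 * ρ) ⊆ (pe n x).target := by
    intro w hw
    rw [mem_closedBall] at hw
    refine hsub ⟨?_, ?_⟩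
    · show 0 ≤ w.1
      have h1 := hfst w
      rw [abs_le] at h1
      linarith [h1.1]
    · rw [mem_ball]; linarith
  refine ⟨(pe n x).source ∩ pe n x ⁻¹' ball (pe n x x) ρ,
    (continuousOn_pe n x).isOpen_inter_preimage (isOpen_pe_source n x) isOpen_ball,
    ⟨mem_pe_source n x, mem_ball_self hρ0⟩, fun y hy hyB => ?_, fun x' hx' k => ?_⟩
  · have h1 : (pe n x y).1 = 0 := (mem_boundary_iff_pe_fst_eq_zero n x hm hy.1).1 hyB
    have h2 := hfst (pe n x y)
    have h3 : dist (pe n x y) (pe n x x) < ρ := hy.2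
    rw [h1, zero_sub, abs_neg, abs_of_pos ha₀pos] at h2
    linarith
  · have hx'v : dist (pe n x x') (pe n x x) < ρ := hx'.2
    have hρt : closedBall (pe n x x') (2 * ρ) ⊆ (pe n x).target := by
      refine Subset.trans (fun w hw => ?_) hballt
      rw [mem_closedBall] at hw ⊢
      calc dist w (pe n x x) ≤ dist w (pe n x x') + dist (pe n x x') (pe n x x) := dist_triangle _ _ _
        _ ≤ 2 * ρ + ρ := by linarith
        _ = 3 * ρ := by ring
    have hCρ : ball (pe n x x) ρ ⊆ ball (pe n x x') (2 * ρ) := fun w hw => by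
      rw [mem_ball] at hw ⊢
      calc dist w (pe n x x') ≤ dist w (pe n x x) + dist (pe n x x) (pe n x x') := dist_triangle _ _ _
        _ < ρ + ρ := by rw [dist_comm (pe n x x)]; linarith
        _ = 2 * ρ := by ring
    exact isIso_restrictToPoint_of_starConvex_partialEquiv R M (pe n x) (isOpen_pe_source n x)
      (continuousOn_pe n x) (continuousOn_pe_symm n x) hx'.1 (by linarith) hρt
      ((convex_ball (pe n x x) ρ).starConvex hx'.2) hx'.2 hCρ rfl hx' k

end SmoothHalfChart

/-! ### The fundamental class of a smooth manifold with boundary from its boundary class -/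

section Fundamental

variable {n : ℕ} {X : Type u} [TopologicalSpace X] [T2Space X] [ChartedSpace (EuclideanHalfSpace (n + 1)) X]
  {m : WithTop ℕ∞} [IsManifold (𝓡∂ (n + 1)) m X]

/-- **A relative class whose boundary is a fundamental class of `∂X` is a fundamental class**,
for `X` a `C¹` (e.g. smooth) topological `(n+1)`-manifold with boundary, `n ≥ 1`, every
connected component of which meets `∂X`: if the local image of `∂w` at every `y ∈ ∂X` generates
`Hₙ(∂X | y; R)` then `w ∈ Hₙ₊₁(X, ∂X; R)` is a relative fundamental class (Spanier's definition,
`IsRelFundamentalClass`).  Proved locally (no compactness, no Spanier Thm. 6.3.5 / Cor. 6.3.10):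
transfer across boundary points in half charts (`HalfChart.isGenerator_toLocal_of_mem_core`),
good balls at interior points, and a clopen argument on the interior. [folklore] -/
theorem isRelFundamentalClass_of_isGenerator_toLocal_δ_of_isManifold (hm : m ≠ 0) (hn : n ≠ 0)
    (w : relativeSingularHomology R R X ((𝓡∂ (n + 1)).boundary X) (n + 1))
    (hgen : ∀ y : ↥((𝓡∂ (n + 1)).boundary X),
      ∃ e : localHomology R R ↥((𝓡∂ (n + 1)).boundary X) y n ≃ₗ[R] R,
        e (singularHomology.toLocal R R y n
          (relativeSingularHomology.δ R R X ((𝓡∂ (n + 1)).boundary X) n w)) = 1)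
    (hcomp : ∀ x : X, ∃ y ∈ (𝓡∂ (n + 1)).boundary X, y ∈ connectedComponent x) :
    IsRelFundamentalClass R ((𝓡∂ (n + 1)).boundary X) w := by
  haveI : Nonempty (Fin n) := ⟨⟨0, Nat.pos_of_ne_zero hn⟩⟩
  haveI : Nontrivial (EuclideanSpace ℝ (Fin n)) := inferInstance
  -- the predicate "`w` is a local generator at `x`"
  let gen : X → Prop := fun x => ∃ hx : x ∈ (((𝓡∂ (n + 1)).boundary X)ᶜ : Set X),
    ∃ e : localHomology R R X x (n + 1) ≃ₗ[R] R,
      e (relativeSingularHomology.toLocal R R ((𝓡∂ (n + 1)).boundary X) ⟨x, hx⟩ (n + 1) w) = 1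
  -- local constancy of `gen` at interior points
  have hloc : ∀ x ∈ (((𝓡∂ (n + 1)).boundary X)ᶜ : Set X), ∃ T : Set X, IsOpen T ∧ x ∈ T ∧
      T ⊆ ((𝓡∂ (n + 1)).boundary X)ᶜ ∧ ∀ x' ∈ T, (gen x' ↔ gen x) := by
    intro x hx
    obtain ⟨T, hTo, hxT, hTc, hiso⟩ :=
      SmoothHalfChart.exists_isOpen_forall_isIso_restrictToPoint_of_not_mem_boundary R R n hm hx
    have hBT : MapsTo (ContinuousMap.id X) ((𝓡∂ (n + 1)).boundary X) (Tᶜ : Set X) :=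
      fun y hy hyT => hTc hyT hy
    let zT : localHomologyOfSet R R X T (n + 1) :=
      relativeSingularHomology.map R R (ContinuousMap.id X) hBT (n + 1) w
    have hres : ∀ (x' : X) (hx' : x' ∈ T), restrictToPoint R R hx' (n + 1) zT =
        relativeSingularHomology.toLocal R R ((𝓡∂ (n + 1)).boundary X) ⟨x', hTc hx'⟩ (n + 1) w := by
      intro x' hx'
      change (relativeSingularHomology.map R R (ContinuousMap.id X) _ (n + 1) ≫
        relativeSingularHomology.map R R (ContinuousMap.id X) _ (n + 1)) w = _
      rw [← relativeSingularHomology.map_comp]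
      rfl
    have hgen' : ∀ (x' : X) (hx' : x' ∈ T),
        gen x' ↔ ∃ e : localHomologyOfSet R R X T (n + 1) ≃ₗ[R] R, e zT = 1 := by
      intro x' hx'
      haveI := hiso x' hx' (n + 1)
      constructor
      · rintro ⟨_, hx'g⟩
        rw [← hres x' hx'] at hx'g
        exact (isGenerator_iff_of_isIso R (restrictToPoint R R hx' (n + 1)) zT).1 hx'g
      · intro hT
        refine ⟨hTc hx', ?_⟩
        rw [← hres x' hx']
        exact (isGenerator_iff_of_isIso R (restrictToPoint R R hx' (n + 1)) zT).2 hT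
    exact ⟨T, hTo, hxT, hTc, fun x' hx' => (hgen' x' hx').trans (hgen' x hxT).symm⟩
  -- every interior point near a boundary point is good
  have hbdry : ∀ p ∈ (𝓡∂ (n + 1)).boundary X, ∃ V : Set X, IsOpen V ∧ p ∈ V ∧
      ∀ y ∈ V, y ∉ (𝓡∂ (n + 1)).boundary X → gen y := by
    intro p hp
    obtain ⟨h, ⟨c⟩⟩ := SmoothHalfChart.exists_halfChart n hm hp
    refine ⟨c.near, c.isOpen_near, c.p_mem_near, fun y hy hyB => ?_⟩
    have hyc : y ∈ c.core := by
      by_contra hyc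
      exact hyB ((c.mem_near_diff_core_iff hy).1 hyc)
    exact ⟨fun hB' => c.B_subset_compl_core hB' hyc,
      c.isGenerator_toLocal_of_mem_core R hp hn w (hgen ⟨p, hp⟩) hyc⟩
  -- the bad set `Z` is clopen, hence a union of components, hence empty
  let Z : Set X := {y | y ∉ (𝓡∂ (n + 1)).boundary X ∧ ¬ gen y}
  have hZo : IsOpen Z := by
    refine isOpen_iff_forall_mem_open.2 fun y ⟨hyB, hyg⟩ => ?_
    obtain ⟨T, hTo, hyT, hTc, hT⟩ := hloc y hyB
    exact ⟨T, fun y' hy' => ⟨hTc hy', fun h' => hyg ((hT y' hy').1 h')⟩, hTo, hyT⟩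
  have hZc : IsClosed Z := by
    refine isClosed_of_closure_subset fun q hq => ?_
    by_cases hqB : q ∈ (𝓡∂ (n + 1)).boundary X
    · obtain ⟨V, hVo, hqV, hV⟩ := hbdry q hqB
      obtain ⟨y, hyV, hyZ⟩ := mem_closure_iff.1 hq V hVo hqV
      exact absurd (hV y hyV hyZ.1) hyZ.2
    · obtain ⟨T, hTo, hqT, hTc, hT⟩ := hloc q hqB
      obtain ⟨y, hyT, hyZ⟩ := mem_closure_iff.1 hq T hTo hqT
      exact ⟨hqB, fun hg => hyZ.2 ((hT y hyT).2 hg)⟩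
  have hZ : Z = ∅ := by
    refine Set.eq_empty_of_forall_notMem fun y hy => ?_
    obtain ⟨y', hy'B, hy'⟩ := hcomp y
    have hsub : connectedComponent y ⊆ Z := (show IsClopen Z from ⟨hZc, hZo⟩).connectedComponent_subset hy
    exact (hsub hy').1 hy'B
  -- conclusion
  intro x
  have hgx : gen x := by
    by_contra hg
    have hx : (x : X) ∈ Z := ⟨x.2, hg⟩
    rw [hZ] at hx
    exact hx
  obtain ⟨_, e, he⟩ := hgx
  exact ⟨e, he⟩

end Fundamental

end Literature.AlgebraicTopology.SingularHomology

end
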